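import Literature.Barriers.CriticalPhenomena.IsingTrivialityFromDimensionFour
import Literature.Probability.LatticeModels.HighDimTrivialityMoments
import Literature.Probability.LatticeModels.PlusFreeComparison
import Literature.Probability.LatticeModels.CriticalTwoPointLower
import Literature.Probability.LatticeModels.CriticalTwoPointBounds
import Literature.Probability.LatticeModels.GaussianPairingBound
import Literature.Probability.LatticeModels.FreeStateGibbs
import HarnessLib

/-!
# Barrier `IsingTrivialityFromDimensionFour`: proofs (assembly from the moment-level facts)

Sibling proof file of `Literature.Barriers.CriticalPhenomena.IsingTrivialityFromDimensionFour`
(theorems only; no statement of that file is changed). The barrier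
`IsingTrivialityFromDimensionFour : ∀ d ≥ 4, ¬ HasNonGaussianCriticalSmearing d` says that for the
nearest-neighbour critical Ising model on `ℤ^d`, `d ≥ 4`, every smeared spin average
`T_{f,L} = Σ_L^{-1/2} ∑_x f(x/L) σ_x` has `⟨exp[z T_{f,L} - (z²/2)⟨T_{f,L}²⟩]⟩_{β_c} → 1`
(`L → ∞`), the expectations being those of the plus state `Literature.Probability.LatticeModels.plusExpect` at
`β_c(d)` (a `limUnder` functional along boxes).

Here it is **derived from the moment-level named facts of the tree**
(`Literature.Probability.LatticeModels.HighDimTrivialityMoments`, Part A), following the printed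
proofs (Aizenman–Duminil-Copin 2021, §6.3, proof of Prop. 1.4, p. 26 of arXiv:1912.07973;
Panis 2023, proof of Thm 5.5, pp. 21–22 of arXiv:2309.05797; Aizenman, CDM 2020, §7,
(7.1)–(7.11) and Cor. 7.3):

* `Literature.Probability.LatticeModels.aizenman_evenMoment_deviation_le` — Aizenman's inequality for the deviation of
  the `2n`-point function from Wick's law, smeared (ADC §6.3 first two displays; Panis Prop. 4.6);
* `Literature.Probability.LatticeModels.newman_evenMoment_le` — Gaussian domination of even moments (`f ≥ 0`);
* `Literature.Probability.LatticeModels.aizenmanDuminilCopin_ursellFourSum_le` — `d = 4`: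
  `Σ_L⁻² ∑_{Λ_{rL}⁴} |U₄| ≤ C r¹² (log L)^{-c}` (ADC Thm 1.3 with §6.3);
* `Literature.Probability.LatticeModels.panis_ursellFourSum_le` — `d ≥ 5`: `≤ C (β⁻⁴ ∨ β⁻²) r^γ L^{4-d}`
  (tree diagram bound and infrared bounds; Aizenman 1982, Fröhlich 1982, Panis §5);
* `Literature.Probability.LatticeModels.exists_freeMeasure` — the free state is a translation-invariant DLR measure with
  correlations `freeCorr` (Friedli–Velenik 2017, Exercise 3.16, Thm. 6.26);
* `Literature.Probability.LatticeModels.spontaneousMagnetization_criticalBeta_eq_zero` — `m*(β_c) = 0` for `d ≥ 3`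
  (Aizenman–Duminil-Copin–Sidoravicius 2015; reduced in `CriticalTwoPointBounds` to the single
  random-current fact `ads_exitProb_tendsto_zero_of_lroTildeSq`).

Everything else is proved, here or in the tree: the summation over `n`
(`Literature.Probability.LatticeModels.abs_mgf_sub_exp_le_of_moment_bounds`), the variance bound
(`Literature.Probability.LatticeModels.integral_normalizedField_sq_le`: translation invariance, Griffiths' first
inequality, a covering argument), the finite-volume flip symmetry
(`Literature.Probability.LatticeModels.isingCorr_free_of_odd_card_holds`), the existence of the plus/free states on spin
products (`hasBoxLimit_isingCorr_plus_holds`, GKS) and `⟨σ_A⟩⁺_{β} = ⟨σ_A⟩^∅_{β}` when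
`m*(β) = 0` (`freeCorr_eq_plusCorr_of_spontaneousMagnetization_eq_zero`, Lebowitz–Martin-Löf).

## Contents

1. *The plus state on local observables.* Every function of the spins in a finite `D ⊂ ℤ^d` is a
   finite linear combination of spin products `σ_A`, `A ⊆ D`
   (`exists_localObs_eq_sum_spinProduct`, via `∏_{x∈D} (1 + η_x σ_x)/2 = 1{σ|_D = η}` — the
   elementary identities are now the general lemmas `halfOnePlusSpin_eq_indicator`,
   `prod_halfOnePlusSpin_eq_indicator`, `prod_halfOnePlusSpin_eq_sum_spinProduct` of
   `Literature.Probability.LatticeModels.FreeStateLimit`); hence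
   its finite-volume plus expectations converge along boxes and, for a measure `μ` whose
   correlations are the plus correlations, `plusExpect d β 0 F = ∫ F dμ`
   (`plusExpect_spinFun_eq_integral`).
2. *Identification.* With such a `μ` at `β_c`: `blockVariance = blockSpinVariance μ`,
   `smearedAverage = normalizedField μ` and
   `criticalSmearedMGF d f L z = exp(-z²V/2) ∫ exp(z T_{f,L}) dμ`, `V = ∫ T_{f,L}² dμ`
   (`criticalSmearedMGF_eq`).
3. *The estimate* `|criticalSmearedMGF d f L z - 1| ≤ exp(z² ⟨T_{|f|,L}²⟩/2) · 24 ‖f‖_∞⁴ z⁴ S(μ;L,r)`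
   (`abs_criticalSmearedMGF_sub_one_le`; ADC §6.3 / Panis (5.x) / Aizenman CDM (7.9)) and the limit
   `criticalSmearedMGF d f L z → 1` whenever `S(μ; L, r) → 0` (`tendsto_criticalSmearedMGF_one`;
   Aizenman CDM 2020, Cor. 7.3).
4. *Assembly.* `IsingTrivialityFromDimensionFour.of_momentFacts` (the six facts above),
   `IsingTrivialityFromDimensionFour.of_printedBounds` (from the exponential-moment facts
   `aizenmanDuminilCopin_mgf_normalizedField_bound_abs`, `panis_mgf_normalizedField_bound`,
   `normalizedField_variance_bounds` of `HighDimTriviality(Moments)` instead), and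
   `IsingTrivialityFromDimensionFour.of_exitProb`, in which `m*(β_c) = 0` is replaced by the
   tree's single random-current input `ads_exitProb_tendsto_zero_of_lroTildeSq` of
   Aizenman–Duminil-Copin–Sidoravicius 2015 (through
   `spontaneousMagnetization_criticalBeta_eq_zero_of_exitProb'` of `CriticalTwoPointBounds`, where
   the infrared bound, `M̃_LRO(β_c) = 0` and the FKG steps are theorems).

What remains for `IsingTrivialityFromDimensionFour_holds` is exactly the discharge of the named
facts listed above (the random-current inequalities, the two `∑ |U₄|` bounds, the free DLR state,
continuity of `m*` at `β_c`).
5. *The literal form of Prop. 1.4 is false.* The statement file's `criticalSmearedMGF_bound_four`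
   (a literal transcription, `@[deprecated]` there since the 2026-08-15 verdict clean-up) reads
   `r_f` as the diameter of the support of `f` (p. 6); the printed proof (§6.3, p. 26) has
   `f` vanishing outside `[-r,r]⁴` with `r ≥ 1`. Single-site test functions refute the diameter
   form (`not_criticalSmearedMGF_bound_four`, with `blockVariance_pos`: `Σ_L(β) ≥ 1`), so the
   hypothesis `h₄` of `IsingTrivialityFromDimensionFour.of_facts` is not satisfiable and the
   barrier rests on `of_momentFacts` / `of_printedBounds` / `of_exitProb` instead.
6. *Assembly from the finite-volume form of Aizenman's inequality.* The lower half of Aizenman's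
   inequality (Gaussian domination of the `2n`-point functions) is now a theorem of the tree
   (`Literature.Probability.LatticeModels.aizenman_nPoint_le_pairingSum_finite_holds`,
   `GaussianPairingBound`); localising both halves to the free state at `β_c`
   (`abs_criticalSmearedMGF_sub_one_le_of_pairingBounds`,
   `tendsto_criticalSmearedMGF_one_of_pairingBounds`) gives
   `IsingTrivialityFromDimensionFour.of_finiteVolumeFacts` (`…_exitProb`): the barrier from five
   named facts — Aizenman's upper inequality in finite volume, the two `∑ |U₄|` bounds, the free
   DLR state, `m*(β_c) = 0` (or the ADS exit-probability input).
7. *Prop. 1.4 in the `plusExpect` vocabulary, derived* (`criticalSmearedMGF_bound_four_nonneg_of_printedBounds`):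
   the corrected form (`f ≥ 0`, box radius `r ≥ 1`) from the DLR-state fact
   `Literature.Probability.LatticeModels.aizenmanDuminilCopin_mgf_normalizedField_bound_abs`, the free state and `m*(β_c) = 0`.
8. *Four facts remain* (`IsingTrivialityFromDimensionFour.of_fourFacts`, `…_exitProb`): the free
   DLR state is a theorem of the tree (`Literature.Probability.LatticeModels.exists_freeMeasure_holds`);
   `criticalSmearedMGF_bound_four_nonneg.of_printedBounds` / `.of_facts`: the statement file's derived shape,
   kernel-checked against the derivation of §7.
9. *The `d > 4` estimate, corrected restatements derived.* The statement file's literal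
   `criticalSmearedMGF_bound_highDim` (ICM 2022 §6.4 display, every signed `f`, no prefactor;
   `@[deprecated]` there since 2026-08-15) is over-stated for signed `f` relative to the primary sources (Aizenman CDM 2020 (7.9)/(8.5),
   Panis 2023 Thm 5.5 carry `exp(z²/2 ⟨T_{|f|,L}²⟩)`); its restatements
   `criticalSmearedMGF_bound_highDim_abs` (general `f`, ratio prefactor) and
   `criticalSmearedMGF_bound_highDim_nonneg` (`f ≥ 0`) are proved from
   `Literature.Probability.LatticeModels.panis_mgf_normalizedField_bound` and `m*(β_c) = 0`
   (`criticalSmearedMGF_bound_highDim_abs.of_facts`, `criticalSmearedMGF_bound_highDim_nonneg.of_facts`,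
   `…of_exitProb`; `criticalSmearedVariance_eq_integral`); the literal form implies the non-negative
   one (`criticalSmearedMGF_bound_highDim.nonneg`, via `T_{-f,L} = -T_{f,L}`); and the ratio form
   gives `criticalSmearedMGF d f L z → 1` for every signed `f`
   (`criticalSmearedMGF_bound_highDim_abs.tendsto`, prefactor bounded in `L` by
   `integral_normalizedField_sq_le`), hence the `d > 4` half of the barrier
   (`criticalSmearedMGF_bound_highDim_abs.not_hasNonGaussianCriticalSmearing`,
   `not_hasNonGaussianCriticalSmearing_of_printedBounds_highDim`).
9. *Three facts remain* (`IsingTrivialityFromDimensionFour.of_threeFacts`, with the two halves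
   `not_hasNonGaussianCriticalSmearing_four` (from `aizenman_pairingSum_sub_nPoint_le_finite` +
   `aizenmanDuminilCopin_ursellFourSum_le`) and `not_hasNonGaussianCriticalSmearing_of_five_le`
   (from `aizenman_pairingSum_sub_nPoint_le_finite` + `panis_ursellFourSum_le`)): `m*(β_c) = 0`
   is a theorem of the tree (`Literature.Probability.LatticeModels.spontaneousMagnetization_criticalBeta_eq_zero_holds`).

## References

* M. Aizenman, H. Duminil-Copin, Ann. of Math. 194 (2021) 163–235 (arXiv:1912.07973), Prop. 1.4,
  Thm 1.3, §6.3 [AizenmanDuminilCopinAnnals2021].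
* R. Panis, arXiv:2309.05797, Prop. 4.6, Thm 5.5 and its proof, Cor. 1.8 [Panis2023Triviality].
* M. Aizenman, Current Developments in Mathematics 2020 (arXiv:2112.04248), §7 (Prop. 7.2,
  Cor. 7.3, (7.6)–(7.11)), §8.1 (8.5) [AizenmanCDM2020].
* S. Friedli, Y. Velenik, *Statistical Mechanics of Lattice Systems* (CUP 2017), §3.6–3.7
  [FriedliVelenik2017].
-/

noncomputable section

open MeasureTheory Filter Topology Finset
open Literature.Probability.LatticeModels Literature.Probability.Percolation

namespace Literature.Barriers.CriticalPhenomena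

variable {d : ℕ}

/-! ### 1. The plus state on local observables -/

/-- A function of the spins in `D` is the sum of its values against the indicators
`1{σ|_D = η}`, `η ∈ {±1}^D`. [folklore] -/
theorem localObs_eq_sum_indicator (D : Finset (Site d)) (G : (↥D → ℤˣ) → ℝ)
    (σ : SpinConfig (Site d)) :
    G (fun x : ↥D => σ x) =
      ∑ η : ↥D → ℤˣ, G η * ∏ x : ↥D, (1 + ((η x : ℤ) : ℝ) * spinAt (x : Site d) σ) / 2 := by
  simp_rw [prod_halfOnePlusSpin_eq_indicator, mul_ite, mul_one, mul_zero]
  rw [Finset.sum_ite_eq Finset.univ (fun x : ↥D => σ x) G, if_pos (Finset.mem_univ _)]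

/-- **Local observables are finite linear combinations of spin products**: for a finite
`D ⊂ ℤ^d` and any `G : {±1}^D → ℝ` there are coefficients `c_B`, `B ⊆ D`, with
`G(σ|_D) = ∑_B c_B σ_B` for every configuration `σ` (Friedli–Velenik 2017, Lemma 3.19: the local
functions are spanned by the `σ_A`). [cite: FriedliVelenik2017, Lemma 3.19] -/
theorem exists_localObs_eq_sum_spinProduct (D : Finset (Site d)) (G : (↥D → ℤˣ) → ℝ) :
    ∃ c : Finset ↥D → ℝ, ∀ σ : SpinConfig (Site d), G (fun x : ↥D => σ x) =
      ∑ B : Finset ↥D, c B * spinProduct (B.map (Function.Embedding.subtype (· ∈ D))) σ := by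
  refine ⟨fun B => ∑ η : ↥D → ℤˣ, G η * ((2 : ℝ)⁻¹ ^ D.card * ∏ x ∈ B, ((η x : ℤ) : ℝ)),
    fun σ => ?_⟩
  rw [localObs_eq_sum_indicator D G σ]
  simp_rw [prod_halfOnePlusSpin_eq_sum_spinProduct, Finset.mul_sum, Finset.sum_mul]
  rw [Finset.sum_comm]
  refine Finset.sum_congr rfl fun B _ => Finset.sum_congr rfl fun η _ => ?_
  ring

/-- Finite-volume expectations of a linear combination of spin products. [folklore] -/
theorem isingExpect_sum_spinProduct {ι : Type*} (Λ : Finset (Site d)) (β h : ℝ)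
    (bc : BoundaryCondition (Site d)) (s : Finset ι) (c : ι → ℝ) (A : ι → Finset (Site d)) :
    isingExpect (zdGraph d) Λ β h bc (fun σ => ∑ i ∈ s, c i * spinProduct (A i) σ) =
      ∑ i ∈ s, c i * isingCorr (zdGraph d) Λ β h bc (A i) := by
  rw [isingExpect_finset_sum' _ _ _ _ β s _ fun i => (measurable_spinProduct (A i)).const_mul (c i)]
  refine Finset.sum_congr rfl fun i _ => ?_
  rw [isingExpect_const_mul' _ _ _ _ β (c i) (measurable_spinProduct (A i))]
  rfl

/-- **Convergence of the finite-volume plus states on the span of spin products** (`β, h ≥ 0`):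
`⟨∑ c_i σ_{A_i}⟩⁺_{B(L);β,h} → ∑ c_i ⟨σ_{A_i}⟩⁺_{β,h}` (Friedli–Velenik 2017, Thm. 3.17; the
tree theorem `hasBoxLimit_isingCorr_plus_holds` and linearity). [cite: FriedliVelenik2017, Thm. 3.17] -/
theorem tendsto_isingExpect_plus_sum_spinProduct {β h : ℝ} (hβ : 0 ≤ β) (hh : 0 ≤ h)
    {ι : Type*} (s : Finset ι) (c : ι → ℝ) (A : ι → Finset (Site d)) :
    Tendsto (fun L : ℕ => isingExpect (zdGraph d) (box d L) β h .plus
      (fun σ => ∑ i ∈ s, c i * spinProduct (A i) σ)) atTop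
      (𝓝 (∑ i ∈ s, c i * plusCorr d β h (A i))) := by
  simp_rw [isingExpect_sum_spinProduct]
  exact tendsto_finsetSum _ fun i _ => (hasBoxLimit_isingCorr_plus_holds hβ hh (A i)).const_mul _

/-- The plus state is linear on the span of spin products:
`⟨∑ c_i σ_{A_i}⟩⁺_{β,h} = ∑ c_i ⟨σ_{A_i}⟩⁺_{β,h}` (`β, h ≥ 0`; Friedli–Velenik 2017, Thm. 3.17).
[cite: FriedliVelenik2017, Thm. 3.17] -/
theorem plusExpect_sum_spinProduct {β h : ℝ} (hβ : 0 ≤ β) (hh : 0 ≤ h)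
    {ι : Type*} (s : Finset ι) (c : ι → ℝ) (A : ι → Finset (Site d)) :
    plusExpect d β h (fun σ => ∑ i ∈ s, c i * spinProduct (A i) σ) =
      ∑ i ∈ s, c i * plusCorr d β h (A i) :=
  (tendsto_isingExpect_plus_sum_spinProduct hβ hh s c A).limUnder_eq

/-- Integrals of a linear combination of spin products. [folklore] -/
theorem integral_sum_spinProduct (μ : Measure (SpinConfig (Site d))) [IsFiniteMeasure μ]
    {ι : Type*} (s : Finset ι) (c : ι → ℝ) (A : ι → Finset (Site d)) :
    ∫ σ, ∑ i ∈ s, c i * spinProduct (A i) σ ∂μ = ∑ i ∈ s, c i * spinCorr μ (A i) := by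
  rw [integral_finsetSum _ fun i _ => (integrable_spinProduct μ (A i)).const_mul (c i)]
  simp_rw [integral_const_mul]
  rfl

/-- **Convergence of the finite-volume plus states on local observables** (`β, h ≥ 0`): for a
function `Φ` of the spin field depending only on the spins in a finite `D`,
`⟨Φ⟩⁺_{B(L);β,h} → ⟨Φ⟩⁺_{β,h}` (Friedli–Velenik 2017, Thm. 3.17, existence of the plus state
on local functions). [cite: FriedliVelenik2017, Thm. 3.17] -/
theorem tendsto_isingExpect_plus_spinFun {β h : ℝ} (hβ : 0 ≤ β) (hh : 0 ≤ h)
    (D : Finset (Site d)) (Φ : (Site d → ℝ) → ℝ)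
    (hΦ : ∀ s t : Site d → ℝ, (∀ x ∈ D, s x = t x) → Φ s = Φ t) :
    Tendsto (fun L : ℕ => isingExpect (zdGraph d) (box d L) β h .plus
      (fun σ => Φ (fun x => spinAt x σ))) atTop
      (𝓝 (plusExpect d β h (fun σ => Φ (fun x => spinAt x σ)))) := by
  classical
  obtain ⟨c, hc⟩ := exists_localObs_eq_sum_spinProduct D
    (fun η => Φ (fun x => if hx : x ∈ D then ((η ⟨x, hx⟩ : ℤ) : ℝ) else 1))
  have hloc : (fun σ : SpinConfig (Site d) => Φ (fun x => spinAt x σ)) = fun σ =>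
      ∑ B : Finset ↥D, c B * spinProduct (B.map (Function.Embedding.subtype (· ∈ D))) σ := by
    funext σ
    rw [← hc σ]
    exact hΦ _ _ fun x hx => by simp [hx, spinAt]
  rw [hloc, plusExpect_sum_spinProduct hβ hh]
  exact tendsto_isingExpect_plus_sum_spinProduct hβ hh _ c _

/-- **The plus state as an integral on local observables.** If a finite measure `μ` has the plus
correlations, `∫ σ_A dμ = ⟨σ_A⟩⁺_{β,h}` for all finite `A` (e.g. the plus measure of
`exists_plusMeasure`, or, when `m*(β) = 0`, the free measure), then for every function `Φ` of
the spin field depending only on finitely many spins, `⟨Φ⟩⁺_{β,h} = ∫ Φ dμ`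
(Friedli–Velenik 2017, Thm. 3.17 with Thm. 6.26: the state `⟨·⟩⁺` is the expectation under
`μ⁺`). [cite: FriedliVelenik2017, Thm. 3.17 and Thm. 6.26] -/
theorem plusExpect_spinFun_eq_integral {β h : ℝ} (hβ : 0 ≤ β) (hh : 0 ≤ h)
    {μ : Measure (SpinConfig (Site d))} [IsFiniteMeasure μ]
    (hμ : ∀ A : Finset (Site d), spinCorr μ A = plusCorr d β h A)
    (D : Finset (Site d)) (Φ : (Site d → ℝ) → ℝ)
    (hΦ : ∀ s t : Site d → ℝ, (∀ x ∈ D, s x = t x) → Φ s = Φ t) :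
    plusExpect d β h (fun σ => Φ (fun x => spinAt x σ)) = ∫ σ, Φ (fun x => spinAt x σ) ∂μ := by
  classical
  obtain ⟨c, hc⟩ := exists_localObs_eq_sum_spinProduct D
    (fun η => Φ (fun x => if hx : x ∈ D then ((η ⟨x, hx⟩ : ℤ) : ℝ) else 1))
  have hloc : (fun σ : SpinConfig (Site d) => Φ (fun x => spinAt x σ)) = fun σ =>
      ∑ B : Finset ↥D, c B * spinProduct (B.map (Function.Embedding.subtype (· ∈ D))) σ := by
    funext σ
    rw [← hc σ]
    exact hΦ _ _ fun x hx => by simp [hx, spinAt]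
  rw [hloc, plusExpect_sum_spinProduct hβ hh, integral_sum_spinProduct]
  simp_rw [hμ]

/-! ### 2. Identification of the barrier's objects with those of `HighDimTriviality` -/

/-- `Σ_L(β) = blockVariance d β L` (the `limUnder` plus state) is `blockSpinVariance μ L` for any
finite measure `μ` with the plus correlations. [cite: AizenmanDuminilCopinAnnals2021, §1.2 (Σ_L)] -/
theorem blockVariance_eq_blockSpinVariance {β : ℝ} (hβ : 0 ≤ β)
    {μ : Measure (SpinConfig (Site d))} [IsFiniteMeasure μ]
    (hμ : ∀ A : Finset (Site d), spinCorr μ A = plusCorr d β 0 A) (L : ℕ) :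
    blockVariance d β L = blockSpinVariance μ L := by
  have key := plusExpect_spinFun_eq_integral hβ le_rfl hμ (box d L)
    (fun s => (∑ x ∈ box d L, s x) ^ 2) fun s t hst => by rw [Finset.sum_congr rfl hst]
  have e : (fun σ => blockSpin d L σ ^ 2) =
      fun σ => (fun s : Site d → ℝ => (∑ x ∈ box d L, s x) ^ 2) fun x => spinAt x σ := rfl
  rw [blockVariance, e, key, blockSpinVariance, latticeBox_eq_box (Nat.cast_nonneg L),
    Nat.floor_natCast]

/-- `T_{f,L} = smearedAverage d β L f` (normalised by the `limUnder` plus state) is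
`normalizedField μ L f` for any finite measure `μ` with the plus correlations.
[cite: AizenmanDuminilCopinAnnals2021, §1.2 (T_{f,L})] -/
theorem smearedAverage_eq_normalizedField {β : ℝ} (hβ : 0 ≤ β)
    {μ : Measure (SpinConfig (Site d))} [IsFiniteMeasure μ]
    (hμ : ∀ A : Finset (Site d), spinCorr μ A = plusCorr d β 0 A) (L : ℕ)
    (f : EuclideanSpace ℝ (Fin d) → ℝ) :
    smearedAverage d β L f = normalizedField μ L f := by
  funext σ
  rw [smearedAverage, normalizedField, blockVariance_eq_blockSpinVariance hβ hμ L, div_eq_inv_mul]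

/-- **The critical moment generating function as an integral.** For a probability measure `μ`
with the plus correlations at `β_c`, a test function `f` vanishing outside `[-r, r]^d` and
`L ≥ 1`: `criticalSmearedMGF d f L z = exp(-z² V/2) ∫ exp(z T_{f,L}) dμ` with
`T_{f,L} = normalizedField μ L f` and `V = ∫ T_{f,L}² dμ`
(the quantity estimated in Aizenman–Duminil-Copin 2021, Prop. 1.4). [cite: AizenmanDuminilCopinAnnals2021, Prop. 1.4 and §6.3] -/
theorem criticalSmearedMGF_eq {μ : Measure (SpinConfig (Site d))} [IsProbabilityMeasure μ]
    (hμ : ∀ A : Finset (Site d), spinCorr μ A = plusCorr d (criticalBeta d) 0 A)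
    {f : EuclideanSpace ℝ (Fin d) → ℝ} {r : ℝ} (hfr : ∀ x, f x ≠ 0 → ∀ i, |x i| ≤ r)
    {L : ℕ} (hL : 1 ≤ L) (z : ℝ) :
    criticalSmearedMGF d f L z =
      Real.exp (-(z ^ 2 / 2 * ∫ σ, normalizedField μ L f σ ^ 2 ∂μ)) *
        ∫ σ, Real.exp (z * normalizedField μ L f σ) ∂μ := by
  have hβ := criticalBeta_nonneg d
  have hL0 : ((L : ℕ) : ℝ) ≠ 0 := Nat.cast_ne_zero.mpr (by omega)
  have hT := smearedAverage_eq_normalizedField hβ hμ L f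
  set Bx : Finset (Site d) := latticeBox d (r / |((L : ℕ) : ℝ)⁻¹|) with hBx
  set s₀ : ℝ := (Real.sqrt (blockSpinVariance μ L))⁻¹ with hs₀
  have hnf : ∀ σ, normalizedField μ L f σ =
      s₀ * ∑ x ∈ Bx, f (((L : ℕ) : ℝ)⁻¹ • siteVec x) * spinAt x σ :=
    fun σ => normalizedField_eq_mul_sum μ hL0 hfr σ
  -- the inner expectation `⟨T²⟩`
  have hV : plusExpect d (criticalBeta d) 0 (fun τ => normalizedField μ L f τ ^ 2) =
      ∫ τ, normalizedField μ L f τ ^ 2 ∂μ := by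
    have key := plusExpect_spinFun_eq_integral hβ le_rfl hμ Bx
      (fun s => (s₀ * ∑ x ∈ Bx, f (((L : ℕ) : ℝ)⁻¹ • siteVec x) * s x) ^ 2)
      fun s t hst => by rw [Finset.sum_congr rfl fun x hx => by rw [hst x hx]]
    have e : (fun τ => normalizedField μ L f τ ^ 2) = fun τ =>
        (fun s : Site d → ℝ => (s₀ * ∑ x ∈ Bx, f (((L : ℕ) : ℝ)⁻¹ • siteVec x) * s x) ^ 2)
          fun x => spinAt x τ := funext fun τ => by rw [hnf τ]
    rw [e, key]
  set V : ℝ := ∫ τ, normalizedField μ L f τ ^ 2 ∂μ with hVdef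
  -- the outer expectation
  have hO : plusExpect d (criticalBeta d) 0
      (fun σ => Real.exp (z * normalizedField μ L f σ - z ^ 2 / 2 * V)) =
      ∫ σ, Real.exp (z * normalizedField μ L f σ - z ^ 2 / 2 * V) ∂μ := by
    have key := plusExpect_spinFun_eq_integral hβ le_rfl hμ Bx
      (fun s => Real.exp (z * (s₀ * ∑ x ∈ Bx, f (((L : ℕ) : ℝ)⁻¹ • siteVec x) * s x) -
        z ^ 2 / 2 * V))
      fun s t hst => by rw [Finset.sum_congr rfl fun x hx => by rw [hst x hx]]
    have e : (fun σ => Real.exp (z * normalizedField μ L f σ - z ^ 2 / 2 * V)) = fun σ =>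
        (fun s : Site d → ℝ => Real.exp (z * (s₀ * ∑ x ∈ Bx,
          f (((L : ℕ) : ℝ)⁻¹ • siteVec x) * s x) - z ^ 2 / 2 * V)) fun x => spinAt x σ :=
      funext fun σ => by rw [hnf σ]
    rw [e, key]
  unfold criticalSmearedMGF
  simp only [hT]
  rw [hV, hO, ← integral_const_mul (Real.exp (-(z ^ 2 / 2 * V)))]
  refine integral_congr_ae (Eventually.of_forall fun σ => ?_)
  dsimp only
  rw [sub_eq_add_neg, Real.exp_add, mul_comm]


/-! ### 3. The estimate and the limit -/

/-- **Odd correlations of a state with the free correlations vanish**: if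
`∫ σ_A dμ = ⟨σ_A⟩^∅_{β,0}` for all finite `A`, then `∫ ∏ᵢ σ_{xᵢ} dμ = 0` for an odd number of
sites (the finite-volume flip symmetry `⟨σ_A⟩^∅_{Λ;β,0} = 0`, `|A|` odd, Friedli–Velenik 2017,
§3.7.1 eq. (3.33), passed to the box limit `hasBoxLimit_isingCorr_free_holds`; this is the
"flip symmetry" invoked in Aizenman–Duminil-Copin 2021, §6.3, p. 26). [cite: FriedliVelenik2017, §3.7.1 eq. (3.33)] -/
theorem integral_prod_spinAt_eq_zero_of_freeCorr {β : ℝ} (hβ : 0 ≤ β)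
    {μ : Measure (SpinConfig (Site d))}
    (hcorr : ∀ A : Finset (Site d), spinCorr μ A = freeCorr d β 0 A) {n : ℕ} (hn : Odd n)
    (x : Fin n → Site d) : ∫ σ, ∏ i, spinAt (x i) σ ∂μ = 0 := by
  classical
  obtain ⟨A, hA, hprod⟩ := exists_prod_spinAt_eq_spinProduct hn x
  simp_rw [hprod]
  rw [show (∫ σ, spinProduct A σ ∂μ) = spinCorr μ A from rfl, hcorr A]
  have hlim := hasBoxLimit_isingCorr_free_holds (d := d) hβ le_rfl A
  obtain ⟨L₀, hL₀⟩ := exists_forall_subset_box d A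
  refine tendsto_nhds_unique hlim (tendsto_const_nhds.congr' ?_)
  filter_upwards [eventually_ge_atTop L₀] with L hL
  exact (isingCorr_free_of_odd_card_holds (zdGraph d) (box d L) β (hL₀ L hL) hA).symm

/-- **The deviation of the critical moment generating function from `1`, one state and one test
function.** Let `μ` be a DLR state at `(β_c, 0)` whose correlations are the plus correlations and
whose odd correlations vanish. For `f ∈ C_0` vanishing outside `[-r, r]^d` and `L ≥ 1`, the
smeared Aizenman inequality (`aizenman_evenMoment_deviation_le`), Gaussian domination
(`newman_evenMoment_le`) and the summation over `n` give
`|⟨exp[z T_{f,L} - (z²/2)⟨T_{f,L}²⟩]⟩_{β_c} - 1| ≤ exp(z²⟨T_{|f|,L}²⟩/2) · 24 ‖f‖_∞⁴ S(μ;L,r) z⁴`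
(Aizenman–Duminil-Copin 2021, §6.3, p. 26, third display; Panis 2023, proof of Thm 5.5, second
display; Aizenman CDM 2020, (7.9)). [cite: AizenmanDuminilCopinAnnals2021, §6.3 (p. 26, third display)] [cite: AizenmanCDM2020, §7 eq. (7.9)] -/
theorem abs_criticalSmearedMGF_sub_one_le
    (hM₁ : aizenman_evenMoment_deviation_le) (hM₂ : newman_evenMoment_le) (hd : 2 ≤ d)
    {μ : Measure (SpinConfig (Site d))} (hμG : μ ∈ isingGibbsMeasures d (criticalBeta d) 0)
    (hμ : ∀ A : Finset (Site d), spinCorr μ A = plusCorr d (criticalBeta d) 0 A)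
    (hodd : ∀ {n : ℕ}, Odd n → ∀ x : Fin n → Site d, ∫ σ, ∏ i, spinAt (x i) σ ∂μ = 0)
    {f : EuclideanSpace ℝ (Fin d) → ℝ} (hf : Continuous f) {r : ℝ} (hr : 1 ≤ r)
    (hfr : ∀ x, f x ≠ 0 → ∀ i, |x i| ≤ r) {L : ℕ} (hL : 1 ≤ L) (z : ℝ) :
    |criticalSmearedMGF d f L z - 1| ≤
      Real.exp (z ^ 2 / 2 * ∫ σ, normalizedField μ L (fun x => |f x|) σ ^ 2 ∂μ) *
        (24 * (⨆ x, |f x|) ^ 4 * ursellFourSum μ L r * z ^ 4) := by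
  haveI : IsProbabilityMeasure μ := hμG.1
  have hβ := criticalBeta_nonneg d
  have hLpos : (0 : ℝ) < (L : ℝ) := Nat.cast_pos.mpr (by omega)
  have hLne : ((L : ℕ) : ℝ) ≠ 0 := hLpos.ne'
  have hfar : ∀ x, (fun y => |f y|) x ≠ 0 → ∀ i, |x i| ≤ r := fun x hx =>
    hfr x (abs_ne_zero.mp hx)
  set E : ℝ := 3 / 2 * (⨆ x, |f x|) ^ 4 * ursellFourSum μ L r with hE_def
  have hE : 0 ≤ E :=
    mul_nonneg (mul_nonneg (by norm_num) (pow_nonneg (iSup_abs_nonneg f) 4))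
      (ursellFourSum_nonneg μ L r)
  have key := abs_mgf_sub_exp_le_of_moment_bounds (μ := μ) (X := normalizedField μ L f)
    (Y := normalizedField μ L fun x => |f x|) (measurable_normalizedField μ hLne hfr)
    (abs_normalizedField_le μ hLne hfr) hE ?_ ?_ ?_ z
  · set V : ℝ := ∫ σ, normalizedField μ L f σ ^ 2 ∂μ with hV
    have hV0 : 0 ≤ V := integral_nonneg fun σ => sq_nonneg _
    rw [criticalSmearedMGF_eq hμ hfr hL z]
    have hpos : 0 < Real.exp (z ^ 2 / 2 * V) := Real.exp_pos _
    have h1 : Real.exp (-(z ^ 2 / 2 * V)) * (∫ σ, Real.exp (z * normalizedField μ L f σ) ∂μ) - 1 =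
        Real.exp (-(z ^ 2 / 2 * V)) *
          ((∫ σ, Real.exp (z * normalizedField μ L f σ) ∂μ) - Real.exp (z ^ 2 / 2 * V)) := by
      rw [mul_sub, Real.exp_neg, inv_mul_cancel₀ hpos.ne']
    rw [h1, abs_mul, Real.abs_exp]
    have hexp1 : Real.exp (-(z ^ 2 / 2 * V)) ≤ 1 :=
      Real.exp_le_one_iff.mpr (neg_nonpos.mpr (mul_nonneg (by positivity) hV0))
    calc Real.exp (-(z ^ 2 / 2 * V)) *
          |(∫ σ, Real.exp (z * normalizedField μ L f σ) ∂μ) - Real.exp (z ^ 2 / 2 * V)|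
        ≤ 1 * (16 * E * z ^ 4 *
            Real.exp (z ^ 2 / 2 * ∫ σ, normalizedField μ L (fun x => |f x|) σ ^ 2 ∂μ)) :=
          mul_le_mul hexp1 key (abs_nonneg _) zero_le_one
      _ = _ := by rw [hE_def]; ring
  · intro n hn
    calc _ ≤ _ := hM₁ hd (criticalBeta d) L r hβ le_rfl hLpos hr μ hμG f hf hfr n hn
      _ = _ := by rw [hE_def]; ring
  · intro n
    exact hM₂ hd (criticalBeta d) L hβ le_rfl hLpos μ hμG _ hf.abs (hasCompactSupport_of_cube hfar)
      (fun x => abs_nonneg _) n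
  · intro n
    rw [integral_normalizedField_pow μ hLne hfr (2 * n + 1)]
    refine mul_eq_zero_of_right _ (Finset.sum_eq_zero fun p _ => ?_)
    rw [hodd ⟨n, rfl⟩ p, mul_zero]

/-- **`⟨exp[z T_{f,L} - (z²/2)⟨T_{f,L}²⟩]⟩_{β_c} → 1` whenever `S(μ; L, r) → 0`** (Aizenman,
CDM 2020, Cor. 7.3: "in any sequential limit in which … `R_{rL}(β) → 0` for each `r < ∞` the
collection of variables `{T_{f,L}}` … converges in distribution, and their joint limit describes a
Gaussian field", here at the level of the moment generating functions of the plus state at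
`β_c`): with `μ` a translation-invariant DLR state at `(β_c, 0)` having the plus correlations
and vanishing odd correlations, for every continuous compactly supported `f` and real `z`.
The variance `⟨T_{|f|,L}²⟩` is bounded uniformly in `L` by translation invariance and Griffiths'
first inequality (`integral_normalizedField_sq_le`). [cite: AizenmanCDM2020, §7 Cor. 7.3 with (7.9)–(7.11)] -/
theorem tendsto_criticalSmearedMGF_one
    (hM₁ : aizenman_evenMoment_deviation_le) (hM₂ : newman_evenMoment_le) (hd : 2 ≤ d)
    {μ : Measure (SpinConfig (Site d))} (hμG : μ ∈ isingGibbsMeasures d (criticalBeta d) 0)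
    (hTI : IsTranslationInvariantMeasure μ)
    (hμ : ∀ A : Finset (Site d), spinCorr μ A = plusCorr d (criticalBeta d) 0 A)
    (hodd : ∀ {n : ℕ}, Odd n → ∀ x : Fin n → Site d, ∫ σ, ∏ i, spinAt (x i) σ ∂μ = 0)
    (hS : ∀ r : ℝ, 1 ≤ r → Tendsto (fun L : ℕ => ursellFourSum μ L r) atTop (𝓝 0))
    {f : EuclideanSpace ℝ (Fin d) → ℝ} (hf : Continuous f) (hfs : HasCompactSupport f) (z : ℝ) :
    Tendsto (fun L : ℕ => criticalSmearedMGF d f L z) atTop (𝓝 1) := by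
  haveI : IsProbabilityMeasure μ := hμG.1
  have hβ := criticalBeta_nonneg d
  obtain ⟨r, hr1, hfr⟩ := exists_cube_of_hasCompactSupport f hfs
  have hfar : ∀ x, (fun y => |f y|) x ≠ 0 → ∀ i, |x i| ≤ r := fun x hx =>
    hfr x (abs_ne_zero.mp hx)
  -- Griffiths' first inequality in the plus state: non-negative pair correlations
  have hG : ∀ x y, 0 ≤ ∫ σ, spinAt x σ * spinAt y σ ∂μ := by
    classical
    intro x y
    by_cases hxy : x = y
    · subst hxy
      simp
    · have hpair : ∀ σ, spinAt x σ * spinAt y σ = spinProduct {x, y} σ := fun σ => by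
        rw [spinProduct, Finset.prod_pair hxy]
      simp_rw [hpair]
      change 0 ≤ spinCorr μ {x, y}
      rw [hμ]
      exact plusCorr_nonneg hβ le_rfl _
  set Cv : ℝ := (⨆ x, |(|f x|)|) ^ 2 * ((((2 * (⌈r⌉₊ + 1) + 1) ^ d : ℕ) : ℝ) ^ 2) with hCv
  have hvar : ∀ L : ℕ, 1 ≤ L → ∫ σ, normalizedField μ L (fun x => |f x|) σ ^ 2 ∂μ ≤ Cv :=
    fun L hL => integral_normalizedField_sq_le μ hTI hG hf.abs hr1 hfar (Nat.one_le_cast.mpr hL)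
  set K : ℝ := Real.exp (z ^ 2 / 2 * Cv) * (24 * (⨆ x, |f x|) ^ 4 * z ^ 4) with hK
  refine tendsto_one_of_abs_sub_le (L₀ := 1) (g := fun L : ℕ => K * ursellFourSum μ L r)
    (fun L hL => ?_) ?_
  · have hB : 0 ≤ 24 * (⨆ x, |f x|) ^ 4 * ursellFourSum μ L r * z ^ 4 :=
      mul_nonneg (mul_nonneg (mul_nonneg (by norm_num) (pow_nonneg (iSup_abs_nonneg f) 4))
        (ursellFourSum_nonneg μ L r)) (by positivity)
    calc |criticalSmearedMGF d f L z - 1|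
        ≤ Real.exp (z ^ 2 / 2 * ∫ σ, normalizedField μ L (fun x => |f x|) σ ^ 2 ∂μ) *
            (24 * (⨆ x, |f x|) ^ 4 * ursellFourSum μ L r * z ^ 4) :=
          abs_criticalSmearedMGF_sub_one_le hM₁ hM₂ hd hμG hμ hodd hf hr1 hfr hL z
      _ ≤ Real.exp (z ^ 2 / 2 * Cv) * (24 * (⨆ x, |f x|) ^ 4 * ursellFourSum μ L r * z ^ 4) :=
          mul_le_mul_of_nonneg_right
            (Real.exp_le_exp.mpr (mul_le_mul_of_nonneg_left (hvar L hL) (by positivity))) hB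
      _ = K * ursellFourSum μ L r := by rw [hK]; ring
  · simpa using (hS r hr1).const_mul K

/-! ### 4. Assembly -/

/-- `d = 4`: the bound `Σ_L⁻² ∑_{Λ_{rL}⁴} |U₄| ≤ C r¹² (log L)^{-c}` at `β_c`
(`aizenmanDuminilCopin_ursellFourSum_le`; Aizenman–Duminil-Copin 2021, Thm 1.3 with §6.3) forces
`S(μ; L, r) → 0`. [cite: AizenmanDuminilCopinAnnals2021, Thm 1.3 and §6.3 (bound on S(L,r,β))] -/
theorem tendsto_ursellFourSum_zero_four (hS₄ : aizenmanDuminilCopin_ursellFourSum_le)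
    {μ : Measure (SpinConfig (Site 4))} (hμG : μ ∈ isingGibbsMeasures 4 (criticalBeta 4) 0)
    {r : ℝ} (hr : 1 ≤ r) : Tendsto (fun L : ℕ => ursellFourSum μ L r) atTop (𝓝 0) := by
  obtain ⟨c, C, hc, -, H⟩ := hS₄
  have hup : Tendsto (fun L : ℕ => C * r ^ 12 / Real.log L ^ c) atTop (𝓝 0) := by
    have hlog : Tendsto (fun L : ℕ => (Real.log L ^ c)⁻¹) atTop (𝓝 0) :=
      ((tendsto_rpow_atTop hc).comp
        (Real.tendsto_log_atTop.comp tendsto_natCast_atTop_atTop)).inv_tendsto_atTop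
    simpa [div_eq_mul_inv] using hlog.const_mul (C * r ^ 12)
  refine squeeze_zero' (Eventually.of_forall fun L => ursellFourSum_nonneg μ L r) ?_ hup
  filter_upwards [eventually_ge_atTop 2] with L hL
  exact H (criticalBeta 4) L r (criticalBeta_nonneg 4) le_rfl (Or.inl rfl)
    (Nat.one_lt_cast.mpr (by omega)) hr μ hμG

/-- `d ≥ 5`: the bound `Σ_L⁻² ∑_{Λ_{rL}⁴} |U₄| ≤ C (β⁻⁴ ∨ β⁻²) r^γ L^{4-d}` at `β = β_c > 0`
(`panis_ursellFourSum_le`; tree diagram bound and infrared bounds, Aizenman 1982, Panis 2023, §5)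
forces `S(μ; L, r) → 0`. [cite: Panis2023Triviality, proof of Thm. 5.5 (pp. 21–22)] [cite: AizenmanCDM2020, §8.1 eq. (8.5)] -/
theorem tendsto_ursellFourSum_zero_highDim (hS₅ : panis_ursellFourSum_le) (hd : 5 ≤ d)
    {μ : Measure (SpinConfig (Site d))} (hμG : μ ∈ isingGibbsMeasures d (criticalBeta d) 0)
    {r : ℝ} (hr : 1 ≤ r) : Tendsto (fun L : ℕ => ursellFourSum μ L r) atTop (𝓝 0) := by
  obtain ⟨C, γ, -, -, H⟩ := hS₅ hd
  have hβc : 0 < criticalBeta d := criticalBeta_pos_holds (d := d) (by omega)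
  set K : ℝ := C * max (criticalBeta d ^ (-4 : ℤ)) (criticalBeta d ^ (-2 : ℤ)) * r ^ γ with hK
  have hup : Tendsto (fun L : ℕ => K / (L : ℝ) ^ (d - 4)) atTop (𝓝 0) := by
    have hpow : Tendsto (fun L : ℕ => ((L : ℝ) ^ (d - 4))⁻¹) atTop (𝓝 0) := by
      have h1 : Tendsto (fun x : ℝ => x ^ (d - 4)) atTop atTop := tendsto_pow_atTop (by omega)
      exact (h1.comp tendsto_natCast_atTop_atTop).inv_tendsto_atTop
    simpa [div_eq_mul_inv] using hpow.const_mul K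
  refine squeeze_zero' (Eventually.of_forall fun L => ursellFourSum_nonneg μ L r) ?_ hup
  filter_upwards [eventually_ge_atTop 1] with L hL
  have h := H (criticalBeta d) L r hβc le_rfl (Nat.one_le_cast.mpr hL) hr μ hμG
  simpa only [hK] using h

/-- **The barrier `IsingTrivialityFromDimensionFour` from the moment-level named facts.**
For every `d ≥ 4` the critical nearest-neighbour Ising model on `ℤ^d` has no non-Gaussian
smeared scaling limit, granted: the smeared Aizenman inequality and Gaussian domination
(`aizenman_evenMoment_deviation_le`, `newman_evenMoment_le`: random currents), the two bounds on
`∑ |U₄|` (`aizenmanDuminilCopin_ursellFourSum_le`, `d = 4`, ADC Thm 1.3 + §6.3;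
`panis_ursellFourSum_le`, `d ≥ 5`, Aizenman 1982 / Panis §5), the existence of the free DLR state
(`exists_freeMeasure`) and the continuity of the magnetisation at `β_c`
(`spontaneousMagnetization_criticalBeta_eq_zero`, Aizenman–Duminil-Copin–Sidoravicius 2015), which
identifies the plus state with the (even) free state at `β_c` (Lebowitz–Martin-Löf). The assembly
is Aizenman–Duminil-Copin 2021, §6.3 (proof of Prop. 1.4) / Aizenman CDM 2020, Cor. 7.3.
[cite: AizenmanDuminilCopinAnnals2021, Prop. 1.4 and §6.3] [cite: AizenmanCDM2020, §7 Cor. 7.3] [cite: Panis2023Triviality, Thm. 5.5] -/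
theorem IsingTrivialityFromDimensionFour.of_momentFacts
    (hM₁ : aizenman_evenMoment_deviation_le) (hM₂ : newman_evenMoment_le)
    (hS₄ : aizenmanDuminilCopin_ursellFourSum_le) (hS₅ : panis_ursellFourSum_le)
    (hF : ∀ (d : ℕ) {β : ℝ}, exists_freeMeasure d (β := β) 0)
    (hm : ∀ {d : ℕ}, spontaneousMagnetization_criticalBeta_eq_zero (d := d)) :
    IsingTrivialityFromDimensionFour := by
  intro d hd
  rintro ⟨f, hf, hfs, z, -, hnot⟩
  refine hnot ?_
  have hβ := criticalBeta_nonneg d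
  have hm' : spontaneousMagnetization d (criticalBeta d) = 0 := hm (d := d) (by omega)
  obtain ⟨μ, hμG, hTI, hcorr⟩ := hF d hβ le_rfl
  have hμ : ∀ A, spinCorr μ A = plusCorr d (criticalBeta d) 0 A := fun A =>
    (hcorr A).trans (freeCorr_eq_plusCorr_of_spontaneousMagnetization_eq_zero hβ hm' A)
  have hodd : ∀ {n : ℕ}, Odd n → ∀ x : Fin n → Site d, ∫ σ, ∏ i, spinAt (x i) σ ∂μ = 0 :=
    fun hn x => integral_prod_spinAt_eq_zero_of_freeCorr hβ hcorr hn x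
  have hS : ∀ r : ℝ, 1 ≤ r → Tendsto (fun L : ℕ => ursellFourSum μ L r) atTop (𝓝 0) := by
    rcases hd.eq_or_lt with h4 | hlt
    · subst h4
      exact fun r hr => tendsto_ursellFourSum_zero_four hS₄ hμG hr
    · exact fun r hr => tendsto_ursellFourSum_zero_highDim hS₅ hlt hμG hr
  exact tendsto_criticalSmearedMGF_one hM₁ hM₂ (by omega) hμG hTI hμ hodd hS hf hfs z

/-- **The barrier from the printed exponential-moment estimates.** The same conclusion from
ADC Prop. 1.4 in the form its proof yields (`aizenmanDuminilCopin_mgf_normalizedField_bound_abs`,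
`d = 4`), Panis Thm 5.5 (`panis_mgf_normalizedField_bound`, `d ≥ 5`) and the uniform variance
bound (`normalizedField_variance_bounds`), for DLR states, together with `exists_freeMeasure` and
`m*(β_c) = 0` (which make the free DLR state carry the plus correlations at `β_c`)
(Aizenman–Duminil-Copin 2021, p. 6: "for `L ≫ 1` the distribution of `T_{f,L}(σ)` is
approximately Gaussian"; Panis 2023, Thm 1.2 / Cor. 1.8: "every sub-sequential scaling limit …
is Gaussian"). [cite: AizenmanDuminilCopinAnnals2021, Prop. 1.4 and p. 6] [cite: Panis2023Triviality, Thm. 5.5 and Cor. 1.8] -/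
theorem IsingTrivialityFromDimensionFour.of_printedBounds
    (h₁ : aizenmanDuminilCopin_mgf_normalizedField_bound_abs) (h₂ : normalizedField_variance_bounds)
    (h₃ : panis_mgf_normalizedField_bound)
    (hF : ∀ (d : ℕ) {β : ℝ}, exists_freeMeasure d (β := β) 0)
    (hm : ∀ {d : ℕ}, spontaneousMagnetization_criticalBeta_eq_zero (d := d)) :
    IsingTrivialityFromDimensionFour := by
  intro d hd
  rintro ⟨f, hf, hfs, z, -, hnot⟩
  refine hnot ?_
  have hβ := criticalBeta_nonneg d
  have hm' : spontaneousMagnetization d (criticalBeta d) = 0 := hm (d := d) (by omega)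
  obtain ⟨μ, hμG, -, hcorr⟩ := hF d hβ le_rfl
  haveI : IsProbabilityMeasure μ := hμG.1
  have hμ : ∀ A, spinCorr μ A = plusCorr d (criticalBeta d) 0 A := fun A =>
    (hcorr A).trans (freeCorr_eq_plusCorr_of_spontaneousMagnetization_eq_zero hβ hm' A)
  obtain ⟨r, hr1, hfr⟩ := exists_cube_of_hasCompactSupport f hfs
  have hfar : ∀ x, (fun y => |f y|) x ≠ 0 → ∀ i, |x i| ≤ r := fun x hx =>
    hfr x (abs_ne_zero.mp hx)
  obtain ⟨Cv, hCv⟩ := (h₂ hd (fun x => |f x|) hf.abs (hasCompactSupport_of_cube hfar)).1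
  -- generic step: a bound `|∫e^{zT} - e^{z²V/2}| ≤ e^{z²Ṽ/2} ε_L`, `ε_L → 0`, gives `MGF → 1`
  have key : ∀ (ε : ℕ → ℝ) (L₀ : ℕ), 1 ≤ L₀ → Tendsto ε atTop (𝓝 0) →
      (∀ L : ℕ, L₀ ≤ L →
        |(∫ σ, Real.exp (z * normalizedField μ L f σ) ∂μ) -
            Real.exp (z ^ 2 / 2 * ∫ σ, normalizedField μ L f σ ^ 2 ∂μ)| ≤
          Real.exp (z ^ 2 / 2 * ∫ σ, normalizedField μ L (fun x => |f x|) σ ^ 2 ∂μ) * ε L) →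
      Tendsto (fun L : ℕ => criticalSmearedMGF d f L z) atTop (𝓝 1) := by
    intro ε L₀ hL₀ hε hb
    refine tendsto_one_of_abs_sub_le (L₀ := L₀) (g := fun L => Real.exp (z ^ 2 / 2 * Cv) * ε L)
      (fun L hL => ?_) (by simpa using hε.const_mul (Real.exp (z ^ 2 / 2 * Cv)))
    have hL1 : 1 ≤ L := hL₀.trans hL
    have hbL := hb L hL
    set V : ℝ := ∫ σ, normalizedField μ L f σ ^ 2 ∂μ with hV
    set W : ℝ := ∫ σ, normalizedField μ L (fun x => |f x|) σ ^ 2 ∂μ with hW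
    have hV0 : 0 ≤ V := integral_nonneg fun σ => sq_nonneg _
    have hWle : W ≤ Cv := hCv (criticalBeta d) L hβ le_rfl (Nat.one_le_cast.mpr hL1) μ hμG
    have hε0 : 0 ≤ ε L :=
      (mul_nonneg_iff_of_pos_left (Real.exp_pos _)).mp ((abs_nonneg _).trans hbL)
    rw [criticalSmearedMGF_eq hμ hfr hL1 z]
    have hpos : 0 < Real.exp (z ^ 2 / 2 * V) := Real.exp_pos _
    have h1 : Real.exp (-(z ^ 2 / 2 * V)) * (∫ σ, Real.exp (z * normalizedField μ L f σ) ∂μ) - 1 =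
        Real.exp (-(z ^ 2 / 2 * V)) *
          ((∫ σ, Real.exp (z * normalizedField μ L f σ) ∂μ) - Real.exp (z ^ 2 / 2 * V)) := by
      rw [mul_sub, Real.exp_neg, inv_mul_cancel₀ hpos.ne']
    rw [h1, abs_mul, Real.abs_exp]
    have hexp1 : Real.exp (-(z ^ 2 / 2 * V)) ≤ 1 :=
      Real.exp_le_one_iff.mpr (neg_nonpos.mpr (mul_nonneg (by positivity) hV0))
    calc Real.exp (-(z ^ 2 / 2 * V)) *
          |(∫ σ, Real.exp (z * normalizedField μ L f σ) ∂μ) - Real.exp (z ^ 2 / 2 * V)|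
        ≤ 1 * (Real.exp (z ^ 2 / 2 * W) * ε L) := mul_le_mul hexp1 hbL (abs_nonneg _) zero_le_one
      _ ≤ 1 * (Real.exp (z ^ 2 / 2 * Cv) * ε L) :=
          mul_le_mul_of_nonneg_left (mul_le_mul_of_nonneg_right
            (Real.exp_le_exp.mpr (mul_le_mul_of_nonneg_left hWle (by positivity))) hε0) zero_le_one
      _ = Real.exp (z ^ 2 / 2 * Cv) * ε L := one_mul _
  rcases hd.eq_or_lt with h4 | hlt
  · subst h4
    obtain ⟨c, C, hc, -, H⟩ := h₁
    refine key (fun L => C * (⨆ x, |f x|) ^ 4 * r ^ 12 * z ^ 4 / Real.log L ^ c) 2 (by norm_num)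
      ?_ fun L hL => H (criticalBeta 4) L r hβ le_rfl (Or.inl rfl) (Nat.one_lt_cast.mpr (by omega))
        hr1 μ hμG f hf hfr z
    have hlog : Tendsto (fun L : ℕ => (Real.log L ^ c)⁻¹) atTop (𝓝 0) :=
      ((tendsto_rpow_atTop hc).comp
        (Real.tendsto_log_atTop.comp tendsto_natCast_atTop_atTop)).inv_tendsto_atTop
    simpa [div_eq_mul_inv] using hlog.const_mul (C * (⨆ x, |f x|) ^ 4 * r ^ 12 * z ^ 4)
  · obtain ⟨C, γ, -, -, H⟩ := h₃ hlt
    have hβc : 0 < criticalBeta d := criticalBeta_pos_holds (d := d) (by omega)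
    refine key (fun L => C * max (criticalBeta d ^ (-4 : ℤ)) (criticalBeta d ^ (-2 : ℤ)) *
        (⨆ x, |f x|) ^ 4 * r ^ γ * z ^ 4 / (L : ℝ) ^ (d - 4)) 1 le_rfl ?_
      fun L hL => H (criticalBeta d) L r hβc le_rfl (Nat.one_le_cast.mpr hL) hr1 μ hμG f hf hfr z
    have hpow : Tendsto (fun L : ℕ => ((L : ℝ) ^ (d - 4))⁻¹) atTop (𝓝 0) := by
      have h1 : Tendsto (fun x : ℝ => x ^ (d - 4)) atTop atTop := tendsto_pow_atTop (by omega)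
      exact (h1.comp tendsto_natCast_atTop_atTop).inv_tendsto_atTop
    simpa [div_eq_mul_inv] using hpow.const_mul (C * max (criticalBeta d ^ (-4 : ℤ))
      (criticalBeta d ^ (-2 : ℤ)) * (⨆ x, |f x|) ^ 4 * r ^ γ * z ^ 4)


/-- **The barrier from the random-current facts alone.** In `of_momentFacts`, the continuity of the
magnetisation at `β_c` may be replaced by the single infinite-volume random-current input of
Aizenman–Duminil-Copin–Sidoravicius 2015 isolated by the tree,
`ads_exitProb_tendsto_zero_of_lroTildeSq` (ADS15 Thm. 3.1 with Thm. 2.3: no percolation of the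
double current when `M̃_LRO = 0`): `m*(β_c) = 0` for `d ≥ 3` then follows
(`spontaneousMagnetization_criticalBeta_eq_zero_of_exitProb'`, with the infrared bound,
`M̃_LRO(β_c) = 0`, FKG and translation invariance all theorems of the tree). Hence the barrier is
reduced to: the two random-current moment inequalities, the two `∑ |U₄|` bounds, the existence of
the free DLR state, and this one fact. [cite: AizenmanDuminilCopinSidoraviciusCMP2015, Thm. 1.2 with Thm. 3.1] [cite: AizenmanDuminilCopinAnnals2021, Prop. 1.4 and §6.3] -/
theorem IsingTrivialityFromDimensionFour.of_exitProb
    (hM₁ : aizenman_evenMoment_deviation_le) (hM₂ : newman_evenMoment_le)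
    (hS₄ : aizenmanDuminilCopin_ursellFourSum_le) (hS₅ : panis_ursellFourSum_le)
    (hF : ∀ (d : ℕ) {β : ℝ}, exists_freeMeasure d (β := β) 0)
    (hexit : ∀ {d : ℕ}, ads_exitProb_tendsto_zero_of_lroTildeSq (d := d)) :
    IsingTrivialityFromDimensionFour :=
  IsingTrivialityFromDimensionFour.of_momentFacts hM₁ hM₂ hS₄ hS₅ hF
    fun {_} => spontaneousMagnetization_criticalBeta_eq_zero_of_exitProb' hexit

/-! ### 5. The literal `diam(supp f)` form of Prop. 1.4 is false: single-site test functions -/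

/-- The plus state of a constant observable is that constant (the box sequence is constant).
[folklore] -/
theorem plusExpect_const (d : ℕ) (β h a : ℝ) : plusExpect d β h (fun _ => a) = a := by
  unfold plusExpect
  simp only [isingExpect_const]
  exact tendsto_const_nhds.limUnder_eq

/-- `Σ_L(β) = ⟨(∑_{x ∈ Λ_L} σ_x)²⟩⁺_β ≥ 1 > 0` for `β ≥ 0`: expanding the square, every term
`⟨σ_x σ_y⟩⁺_β` is non-negative (Griffiths' first inequality in the plus state, `plusCorr_nonneg`)
and the diagonal term at the origin is `⟨1⟩ = 1`. [folklore] -/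
theorem blockVariance_pos {d : ℕ} {β : ℝ} (hβ : 0 ≤ β) (L : ℕ) : 0 < blockVariance d β L := by
  classical
  set A : Site d × Site d → Finset (Site d) := fun p => if p.1 = p.2 then ∅ else {p.1, p.2}
    with hA
  have hexp : (fun σ : SpinConfig (Site d) => blockSpin d L σ ^ 2) =
      fun σ => ∑ p ∈ box d L ×ˢ box d L, (1 : ℝ) * spinProduct (A p) σ := by
    funext σ
    rw [blockSpin, sq, Finset.sum_mul_sum, ← Finset.sum_product']
    refine Finset.sum_congr rfl fun p _ => ?_
    rw [one_mul]
    by_cases hp : p.1 = p.2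
    · simp [hA, hp, spinProduct]
    · simp [hA, hp, spinProduct, Finset.prod_pair hp]
  rw [blockVariance, hexp, plusExpect_sum_spinProduct hβ le_rfl]
  have h0 : ((0 : Site d), (0 : Site d)) ∈ box d L ×ˢ box d L :=
    Finset.mem_product.mpr ⟨zero_mem_box d L, zero_mem_box d L⟩
  calc (0 : ℝ) < 1 := one_pos
    _ = 1 * plusCorr d β 0 (A (0, 0)) := by simp [hA, plusCorr_empty hβ le_rfl]
    _ ≤ ∑ p ∈ box d L ×ˢ box d L, 1 * plusCorr d β 0 (A p) :=
        Finset.single_le_sum (f := fun p => 1 * plusCorr d β 0 (A p))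
          (fun p _ => by rw [one_mul]; exact plusCorr_nonneg hβ le_rfl _) h0

/-- A non-zero lattice site has Euclidean norm at least `1`. [folklore] -/
theorem one_le_norm_siteVec {d : ℕ} {x : Site d} (hx : x ≠ 0) : 1 ≤ ‖siteVec x‖ := by
  obtain ⟨i, hi⟩ : ∃ i, x i ≠ 0 := by
    by_contra h
    push Not at h
    exact hx (funext h)
  have h1 : (1 : ℝ) ≤ |(x i : ℝ)| := by
    rw [← Int.cast_abs]
    exact_mod_cast Int.one_le_abs hi
  calc (1 : ℝ) ≤ |(x i : ℝ)| := h1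
    _ = |siteVec x i| := by rw [siteVec_apply]
    _ ≤ ‖siteVec x‖ := by simpa using PiLp.norm_apply_le (siteVec x) i

/-- The plus state of an observable `a + b σ₀` is `a + b ⟨σ₀⟩⁺` (`β, h ≥ 0`). [folklore] -/
theorem plusExpect_affine_spinAt {d : ℕ} {β h : ℝ} (hβ : 0 ≤ β) (hh : 0 ≤ h) (a b : ℝ)
    (F : SpinConfig (Site d) → ℝ) (hF : ∀ σ, F σ = a + b * spinAt 0 σ) :
    plusExpect d β h F = a + b * plusCorr d β h {0} := by
  have hF' : F = fun σ => ∑ i : Fin 2, (![a, b] i) * spinProduct (![∅, {0}] i) σ := by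
    funext σ
    rw [hF σ, Fin.sum_univ_two]
    simp [spinProduct]
  rw [hF', plusExpect_sum_spinProduct hβ hh, Fin.sum_univ_two]
  simp [plusCorr_empty hβ hh]

-- `linter.deprecated` off for this declaration only: its statement is, by design, the negation of the
-- deprecated literal transcription `criticalSmearedMGF_bound_four` (the refutation is kept, D-0014).
set_option linter.deprecated false in
/-- **The `diam(supp f)` reading of Aizenman–Duminil-Copin 2021, Prop. 1.4, is false.** The fact
`criticalSmearedMGF_bound_four` of the statement file (deprecated there since the 2026-08-15 verdict
clean-up, superseded by `criticalSmearedMGF_bound_four_nonneg`) transcribes Prop. 1.4 with `r_f` = the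
diameter of the support of `f` (as the sentence after the display on p. 6 of arXiv:1912.07973
reads), whereas the proof (§6.3, p. 26) is for `f` vanishing outside `[-r, r]⁴` with "by
definition `r ≥ 1`". With the literal diameter the bound fails: for a bump `f_ε` of height `1`
supported in the ball `B(0, ε)`, `ε < 1/2`, and `L = 2`, only the origin contributes to
`T_{f_ε,2} = σ₀ / Σ₂^{1/2}`, so that `⟨exp[±z T - (z²/2)⟨T²⟩]⟩ = e^{-2}(cosh 2 ± ⟨σ₀⟩ sinh 2)`
at `z = 2 Σ₂^{1/2}`; the two deviations from `1` add up to `1 - e^{-4}`, while the claimed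
bound `C ‖f_ε‖_∞⁴ (2ε)¹² z⁴ / (log 2)^c` tends to `0` with `ε`. The corrected (proved-in-print)
form, with the box radius `r ≥ 1`, is `Literature.Probability.LatticeModels.aizenmanDuminilCopin_mgf_normalizedField_bound_abs`,
from which the barrier is derived in `IsingTrivialityFromDimensionFour.of_printedBounds`.
[cite: AizenmanDuminilCopinAnnals2021, Prop. 1.4 (p. 6) versus §6.3 (p. 26, "by definition r ≥ 1")] -/
theorem not_criticalSmearedMGF_bound_four : ¬ criticalSmearedMGF_bound_four := by
  rintro ⟨c, C, hc, hC, H⟩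
  have hβ := criticalBeta_nonneg 4
  -- the block variance at `L = 2` and its square root
  set V : ℝ := blockVariance 4 (criticalBeta 4) 2 with hV
  have hVpos : 0 < V := blockVariance_pos hβ 2
  set s : ℝ := Real.sqrt V with hs
  have hspos : 0 < s := Real.sqrt_pos.mpr hVpos
  -- the constant of the claimed bound at `z = 2s`, `‖f‖ ≤ 1`, `diam ≤ 2ε ≤ 1`
  set K : ℝ := C * (2 : ℝ) ^ 12 * (2 * s) ^ 4 / Real.log 2 ^ c with hK
  have hlog : 0 < Real.log 2 ^ c := Real.rpow_pos_of_pos (Real.log_pos one_lt_two) c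
  have hKpos : 0 < K := by positivity
  -- the radius
  set ε : ℝ := min (1 / 2) (1 / (8 * K)) with hε
  have hεpos : 0 < ε := lt_min (by norm_num) (by positivity)
  have hεhalf : ε ≤ 1 / 2 := min_le_left _ _
  have hεK : ε ≤ 1 / (8 * K) := min_le_right _ _
  have hε1 : ε ≤ 1 := hεhalf.trans (by norm_num)
  -- the test function
  set f : EuclideanSpace ℝ (Fin 4) → ℝ := fun y => max 0 (1 - ‖y‖ / ε) with hf
  have hf_cont : Continuous f := continuous_const.max (continuous_const.sub (continuous_norm.div_const _))
  have hf_nonneg : ∀ y, 0 ≤ f y := fun y => le_max_left _ _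
  have hf_le_one : ∀ y, f y ≤ 1 := fun y =>
    max_le zero_le_one (sub_le_self _ (div_nonneg (norm_nonneg _) hεpos.le))
  have hf_zero : ∀ y, ε ≤ ‖y‖ → f y = 0 := fun y hy => by
    have : 1 - ‖y‖ / ε ≤ 0 := by
      rw [sub_nonpos, le_div_iff₀ hεpos, one_mul]
      exact hy
    exact max_eq_left this
  have hf_supp : Function.support f ⊆ Metric.closedBall 0 ε := by
    intro y hy
    rw [Metric.mem_closedBall, dist_zero_right]
    by_contra h
    exact hy (hf_zero y (le_of_not_ge h))
  have hf_cpt : HasCompactSupport f :=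
    HasCompactSupport.intro (isCompact_closedBall 0 ε) fun y hy =>
      Function.notMem_support.mp fun h => hy (hf_supp h)
  have hf_sup : (⨆ y, |f y|) ≤ 1 := ciSup_le fun y => by
    rw [abs_of_nonneg (hf_nonneg y)]; exact hf_le_one y
  have hf_diam : Metric.diam (Function.support f) ≤ 2 * ε :=
    (Metric.diam_mono hf_supp Metric.isBounded_closedBall).trans (Metric.diam_closedBall hεpos.le)
  have hf0 : f 0 = 1 := by simp [hf]
  -- only the origin contributes to the lattice sum at `L = 2`
  have hsum : ∀ σ : SpinConfig (Site 4),
      (∑ᶠ x : Site 4, f (((2 : ℕ) : ℝ)⁻¹ • siteVec x) * spinAt x σ) = spinAt 0 σ := by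
    intro σ
    rw [finsum_eq_single _ 0]
    · have h0 : siteVec (0 : Site 4) = 0 := by
        ext i; simp
      rw [h0, smul_zero, hf0, one_mul]
    · intro x hx
      rw [hf_zero _ ?_, zero_mul]
      rw [norm_smul, norm_inv, Nat.cast_ofNat, Real.norm_eq_abs, abs_of_pos two_pos]
      calc ε ≤ 1 / 2 := hεhalf
        _ = 2⁻¹ * 1 := by norm_num
        _ ≤ 2⁻¹ * ‖siteVec x‖ := by gcongr; exact one_le_norm_siteVec hx
  have hT : ∀ σ : SpinConfig (Site 4), smearedAverage 4 (criticalBeta 4) 2 f σ = spinAt 0 σ / s := by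
    intro σ
    rw [smearedAverage, hsum σ]
  -- the inner expectation `⟨T²⟩ = 1/s²`
  have hT2 : plusExpect 4 (criticalBeta 4) 0
      (fun τ => smearedAverage 4 (criticalBeta 4) 2 f τ ^ 2) = (s ^ 2)⁻¹ := by
    have : (fun τ => smearedAverage 4 (criticalBeta 4) 2 f τ ^ 2) = fun _ => (s ^ 2)⁻¹ := by
      funext τ
      rw [hT τ, div_pow, spinAt_sq, one_div]
    rw [this, plusExpect_const]
  -- the moment generating function at `z = ±2s`
  set m : ℝ := plusCorr 4 (criticalBeta 4) 0 {0} with hm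
  have hMGF : ∀ η : ℝ, (η = 1 ∨ η = -1) →
      criticalSmearedMGF 4 f 2 (η * (2 * s)) =
        (1 + Real.exp (-4)) / 2 + η * ((1 - Real.exp (-4)) / 2) * m := by
    intro η hη
    have hη2 : η ^ 2 = 1 := by rcases hη with rfl | rfl <;> norm_num
    unfold criticalSmearedMGF
    rw [hT2]
    refine plusExpect_affine_spinAt hβ le_rfl _ _ _ fun σ => ?_
    rw [hT σ]
    have hexp : η * (2 * s) * (spinAt 0 σ / s) - (η * (2 * s)) ^ 2 / 2 * (s ^ 2)⁻¹ =
        2 * (η * spinAt 0 σ) - 2 := by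
      have hs0 : s ≠ 0 := hspos.ne'
      rcases hη with rfl | rfl <;> field_simp
    rw [hexp]
    have hprod : η * spinAt 0 σ = 1 ∨ η * spinAt 0 σ = -1 := by
      rcases hη with rfl | rfl <;> rcases spinAt_eq_one_or_eq_neg_one 0 σ with h | h <;>
        simp [h]
    have key : ∀ t : ℝ, (t = 1 ∨ t = -1) →
        Real.exp (2 * t - 2) = (1 + Real.exp (-4)) / 2 + (1 - Real.exp (-4)) / 2 * t := by
      intro t ht
      rcases ht with rfl | rfl
      · rw [show (2 : ℝ) * 1 - 2 = 0 by norm_num, Real.exp_zero]; ring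
      · rw [show (2 : ℝ) * (-1) - 2 = -4 by norm_num]; ring
    rw [key _ hprod]
    rcases hη with rfl | rfl <;> ring
  -- the two instances of the claimed bound
  have hR : ∀ η : ℝ, (η = 1 ∨ η = -1) →
      |criticalSmearedMGF 4 f 2 (η * (2 * s)) - 1| ≤ K * ε := by
    intro η hη
    have hη4 : (η * (2 * s)) ^ 4 = (2 * s) ^ 4 := by
      rcases hη with rfl | rfl <;> ring
    have h := H f hf_cont hf_cpt 2 le_rfl (η * (2 * s))
    rw [hη4] at h
    refine h.trans ?_
    have hsup0 : 0 ≤ ⨆ y, |f y| := iSup_abs_nonneg f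
    have hdiam0 : 0 ≤ Metric.diam (Function.support f) := Metric.diam_nonneg
    calc C * (⨆ y, |f y|) ^ 4 * Metric.diam (Function.support f) ^ 12 * (2 * s) ^ 4 /
          Real.log (2 : ℕ) ^ c
        ≤ C * 1 ^ 4 * (2 * ε) ^ 12 * (2 * s) ^ 4 / Real.log (2 : ℕ) ^ c := by
          have : Real.log ((2 : ℕ) : ℝ) ^ c = Real.log 2 ^ c := by norm_num
          rw [this]
          gcongr
      _ = K * ε ^ 12 := by
          rw [hK]
          have : Real.log ((2 : ℕ) : ℝ) ^ c = Real.log 2 ^ c := by norm_num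
          rw [this]
          ring
      _ ≤ K * ε := by
          gcongr
          calc ε ^ 12 ≤ ε ^ 1 := pow_le_pow_of_le_one hεpos.le hε1 (by norm_num)
            _ = ε := pow_one ε
  -- contradiction: the two deviations add up to `1 - e^{-4} > 1/2`, but `2Kε ≤ 1/4`
  have hplus := hR 1 (Or.inl rfl)
  have hminus := hR (-1) (Or.inr rfl)
  rw [hMGF 1 (Or.inl rfl)] at hplus
  rw [hMGF (-1) (Or.inr rfl)] at hminus
  have hsum2 : 1 - Real.exp (-4) ≤ 2 * (K * ε) := by
    have := (abs_add_le _ _).trans (add_le_add hplus hminus)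
    have e4 : ((1 + Real.exp (-4)) / 2 + 1 * ((1 - Real.exp (-4)) / 2) * m - 1) +
        ((1 + Real.exp (-4)) / 2 + -1 * ((1 - Real.exp (-4)) / 2) * m - 1) =
        -(1 - Real.exp (-4)) := by ring
    rw [e4, abs_neg, abs_of_nonneg (sub_nonneg.mpr (Real.exp_le_one_iff.mpr (by norm_num)))]
      at this
    linarith
  have hexp4 : Real.exp (-4) ≤ 1 / 2 := by
    have h5 : (5 : ℝ) ≤ Real.exp 4 := by
      have := Real.add_one_le_exp (4 : ℝ)
      linarith
    rw [Real.exp_neg]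
    rw [inv_le_comm₀ (Real.exp_pos 4) (by norm_num)]
    linarith
  have hKε : K * ε ≤ 1 / 8 := by
    calc K * ε ≤ K * (1 / (8 * K)) := by gcongr
      _ = 1 / 8 := by field_simp
  linarith

/-! ### 6. Assembly from the finite-volume form of Aizenman's inequality (lower half now proved) -/

/-- **The deviation of the critical moment generating function from `1`, one state satisfying the
two halves of Aizenman's inequality.** As `abs_criticalSmearedMGF_sub_one_le`, but with the
random-current input localised to the state `μ` at hand: `PairingLowerBound μ` (Gaussian
domination of the `2n`-point functions) and `PairingUpperBound μ` (Aizenman's bound on the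
deviation from Wick's law) replace the all-states named facts `newman_evenMoment_le`,
`aizenman_evenMoment_deviation_le` (smearing: `integral_normalizedField_pow_le_of_pairingLowerBound`,
`abs_integral_normalizedField_pow_sub_le_of_pairingBounds` of `HighDimTrivialityWick`; summation
over `n`: `abs_mgf_sub_exp_le_of_moment_bounds`). For `f ∈ C_0` vanishing outside `[-r, r]^d`,
`L ≥ 1` and real `z`:
`|⟨exp[z T_{f,L} - (z²/2)⟨T_{f,L}²⟩]⟩_{β_c} - 1| ≤ exp(z²⟨T_{|f|,L}²⟩/2) · 24 ‖f‖_∞⁴ S(μ;L,r) z⁴`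
(Aizenman–Duminil-Copin 2021, §6.3, p. 26, third display). [cite: AizenmanDuminilCopinAnnals2021, §6.3 (p. 26, first three displays)] -/
theorem abs_criticalSmearedMGF_sub_one_le_of_pairingBounds
    {μ : Measure (SpinConfig (Site d))} (hμG : μ ∈ isingGibbsMeasures d (criticalBeta d) 0)
    (hμ : ∀ A : Finset (Site d), spinCorr μ A = plusCorr d (criticalBeta d) 0 A)
    (hlow : PairingLowerBound μ) (hup : PairingUpperBound μ)
    (hodd : ∀ {n : ℕ}, Odd n → ∀ x : Fin n → Site d, ∫ σ, ∏ i, spinAt (x i) σ ∂μ = 0)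
    {f : EuclideanSpace ℝ (Fin d) → ℝ} (hf : Continuous f) {r : ℝ}
    (hfr : ∀ x, f x ≠ 0 → ∀ i, |x i| ≤ r) {L : ℕ} (hL : 1 ≤ L) (z : ℝ) :
    |criticalSmearedMGF d f L z - 1| ≤
      Real.exp (z ^ 2 / 2 * ∫ σ, normalizedField μ L (fun x => |f x|) σ ^ 2 ∂μ) *
        (24 * (⨆ x, |f x|) ^ 4 * ursellFourSum μ L r * z ^ 4) := by
  haveI : IsProbabilityMeasure μ := hμG.1
  have hLpos : (0 : ℝ) < (L : ℝ) := Nat.cast_pos.mpr (by omega)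
  have hLne : ((L : ℕ) : ℝ) ≠ 0 := hLpos.ne'
  have hfar : ∀ x, (fun y => |f y|) x ≠ 0 → ∀ i, |x i| ≤ r := fun x hx =>
    hfr x (abs_ne_zero.mp hx)
  set E : ℝ := 3 / 2 * (⨆ x, |f x|) ^ 4 * ursellFourSum μ L r with hE_def
  have hE : 0 ≤ E :=
    mul_nonneg (mul_nonneg (by norm_num) (pow_nonneg (iSup_abs_nonneg f) 4))
      (ursellFourSum_nonneg μ L r)
  have key := abs_mgf_sub_exp_le_of_moment_bounds (μ := μ) (X := normalizedField μ L f)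
    (Y := normalizedField μ L fun x => |f x|) (measurable_normalizedField μ hLne hfr)
    (abs_normalizedField_le μ hLne hfr) hE ?_ ?_ ?_ z
  · set V : ℝ := ∫ σ, normalizedField μ L f σ ^ 2 ∂μ with hV
    have hV0 : 0 ≤ V := integral_nonneg fun σ => sq_nonneg _
    rw [criticalSmearedMGF_eq hμ hfr hL z]
    have hpos : 0 < Real.exp (z ^ 2 / 2 * V) := Real.exp_pos _
    have h1 : Real.exp (-(z ^ 2 / 2 * V)) * (∫ σ, Real.exp (z * normalizedField μ L f σ) ∂μ) - 1 =
        Real.exp (-(z ^ 2 / 2 * V)) *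
          ((∫ σ, Real.exp (z * normalizedField μ L f σ) ∂μ) - Real.exp (z ^ 2 / 2 * V)) := by
      rw [mul_sub, Real.exp_neg, inv_mul_cancel₀ hpos.ne']
    rw [h1, abs_mul, Real.abs_exp]
    have hexp1 : Real.exp (-(z ^ 2 / 2 * V)) ≤ 1 :=
      Real.exp_le_one_iff.mpr (neg_nonpos.mpr (mul_nonneg (by positivity) hV0))
    calc Real.exp (-(z ^ 2 / 2 * V)) *
          |(∫ σ, Real.exp (z * normalizedField μ L f σ) ∂μ) - Real.exp (z ^ 2 / 2 * V)|
        ≤ 1 * (16 * E * z ^ 4 *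
            Real.exp (z ^ 2 / 2 * ∫ σ, normalizedField μ L (fun x => |f x|) σ ^ 2 ∂μ)) :=
          mul_le_mul hexp1 key (abs_nonneg _) zero_le_one
      _ = _ := by rw [hE_def]; ring
  · intro n hn
    calc _ ≤ _ := abs_integral_normalizedField_pow_sub_le_of_pairingBounds hlow hup hLpos hf hfr hn
      _ = _ := by rw [hE_def]; ring
  · intro n
    exact integral_normalizedField_pow_le_of_pairingLowerBound hlow hLpos
      (hasCompactSupport_of_cube hfar) (fun x => abs_nonneg _) n
  · intro n
    rw [integral_normalizedField_pow μ hLne hfr (2 * n + 1)]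
    refine mul_eq_zero_of_right _ (Finset.sum_eq_zero fun p _ => ?_)
    rw [hodd ⟨n, rfl⟩ p, mul_zero]

/-- **`⟨exp[z T_{f,L} - (z²/2)⟨T_{f,L}²⟩]⟩_{β_c} → 1` whenever `S(μ; L, r) → 0`**, for a
translation-invariant DLR state `μ` at `(β_c, 0)` with the plus correlations and vanishing odd
correlations which satisfies the two halves of Aizenman's inequality (local form of
`tendsto_criticalSmearedMGF_one`; Aizenman, CDM 2020, Cor. 7.3). [cite: AizenmanCDM2020, §7 Cor. 7.3 with (7.9)–(7.11)] -/
theorem tendsto_criticalSmearedMGF_one_of_pairingBounds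
    {μ : Measure (SpinConfig (Site d))} (hμG : μ ∈ isingGibbsMeasures d (criticalBeta d) 0)
    (hTI : IsTranslationInvariantMeasure μ)
    (hμ : ∀ A : Finset (Site d), spinCorr μ A = plusCorr d (criticalBeta d) 0 A)
    (hlow : PairingLowerBound μ) (hup : PairingUpperBound μ)
    (hodd : ∀ {n : ℕ}, Odd n → ∀ x : Fin n → Site d, ∫ σ, ∏ i, spinAt (x i) σ ∂μ = 0)
    (hS : ∀ r : ℝ, 1 ≤ r → Tendsto (fun L : ℕ => ursellFourSum μ L r) atTop (𝓝 0))
    {f : EuclideanSpace ℝ (Fin d) → ℝ} (hf : Continuous f) (hfs : HasCompactSupport f) (z : ℝ) :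
    Tendsto (fun L : ℕ => criticalSmearedMGF d f L z) atTop (𝓝 1) := by
  haveI : IsProbabilityMeasure μ := hμG.1
  have hβ := criticalBeta_nonneg d
  obtain ⟨r, hr1, hfr⟩ := exists_cube_of_hasCompactSupport f hfs
  have hfar : ∀ x, (fun y => |f y|) x ≠ 0 → ∀ i, |x i| ≤ r := fun x hx =>
    hfr x (abs_ne_zero.mp hx)
  -- Griffiths' first inequality in the plus state: non-negative pair correlations
  have hG : ∀ x y, 0 ≤ ∫ σ, spinAt x σ * spinAt y σ ∂μ := by
    classical
    intro x y
    by_cases hxy : x = y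
    · subst hxy
      simp
    · have hpair : ∀ σ, spinAt x σ * spinAt y σ = spinProduct {x, y} σ := fun σ => by
        rw [spinProduct, Finset.prod_pair hxy]
      simp_rw [hpair]
      change 0 ≤ spinCorr μ {x, y}
      rw [hμ]
      exact plusCorr_nonneg hβ le_rfl _
  set Cv : ℝ := (⨆ x, |(|f x|)|) ^ 2 * ((((2 * (⌈r⌉₊ + 1) + 1) ^ d : ℕ) : ℝ) ^ 2) with hCv
  have hvar : ∀ L : ℕ, 1 ≤ L → ∫ σ, normalizedField μ L (fun x => |f x|) σ ^ 2 ∂μ ≤ Cv :=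
    fun L hL => integral_normalizedField_sq_le μ hTI hG hf.abs hr1 hfar (Nat.one_le_cast.mpr hL)
  set K : ℝ := Real.exp (z ^ 2 / 2 * Cv) * (24 * (⨆ x, |f x|) ^ 4 * z ^ 4) with hK
  refine tendsto_one_of_abs_sub_le (L₀ := 1) (g := fun L : ℕ => K * ursellFourSum μ L r)
    (fun L hL => ?_) ?_
  · have hB : 0 ≤ 24 * (⨆ x, |f x|) ^ 4 * ursellFourSum μ L r * z ^ 4 :=
      mul_nonneg (mul_nonneg (mul_nonneg (by norm_num) (pow_nonneg (iSup_abs_nonneg f) 4))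
        (ursellFourSum_nonneg μ L r)) (by positivity)
    calc |criticalSmearedMGF d f L z - 1|
        ≤ Real.exp (z ^ 2 / 2 * ∫ σ, normalizedField μ L (fun x => |f x|) σ ^ 2 ∂μ) *
            (24 * (⨆ x, |f x|) ^ 4 * ursellFourSum μ L r * z ^ 4) :=
          abs_criticalSmearedMGF_sub_one_le_of_pairingBounds hμG hμ hlow hup hodd hf hfr hL z
      _ ≤ Real.exp (z ^ 2 / 2 * Cv) * (24 * (⨆ x, |f x|) ^ 4 * ursellFourSum μ L r * z ^ 4) :=
          mul_le_mul_of_nonneg_right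
            (Real.exp_le_exp.mpr (mul_le_mul_of_nonneg_left (hvar L hL) (by positivity))) hB
      _ = K * ursellFourSum μ L r := by rw [hK]; ring
  · simpa using (hS r hr1).const_mul K

/-- **The barrier from the finite-volume form of Aizenman's inequality.** For every `d ≥ 4` the
critical nearest-neighbour Ising model on `ℤ^d` has no non-Gaussian smeared scaling limit,
granted: the **upper** half of Aizenman's inequality in finite volume
(`aizenman_pairingSum_sub_nPoint_le_finite`: free boundary condition, zero field, the form the
switching lemma of [Aiz82] proves), the two bounds on `∑ |U₄|`
(`aizenmanDuminilCopin_ursellFourSum_le`, `d = 4`; `panis_ursellFourSum_le`, `d ≥ 5`), the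
existence of the free DLR state (`exists_freeMeasure`) and the continuity of the magnetisation
at `β_c` (`spontaneousMagnetization_criticalBeta_eq_zero`). Compared with `of_momentFacts`, the
Gaussian domination of the even moments is no longer an input: the lower half of Aizenman's
inequality is the theorem `aizenman_nPoint_le_pairingSum_finite_holds` (`GaussianPairingBound`),
and both halves pass from the free boxes to the free state by
`pairingLowerBound_of_finite` / `pairingUpperBound_of_finite` (`HighDimTrivialityWick`, Part M),
the free state carrying the plus correlations at `β_c` since `m*(β_c) = 0` (Lebowitz–Martin-Löf).
[cite: AizenmanDuminilCopinAnnals2021, Prop. 1.4 and §6.3 (p. 26)] [cite: AizenmanCDM2020, §7 Cor. 7.3] [cite: Panis2023Triviality, Thm. 5.5] -/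
@[deprecated "vacuous since 2026-08-15: its hypothesis Literature.Probability.LatticeModels.aizenman_pairingSum_sub_nPoint_le_finite (the S_{2n-4} form quoted by Aizenman-Duminil-Copin 2021 (6.44)) is refuted (not_aizenman_pairingSum_sub_nPoint_le_finite, AizenmanWickBoundLocal.lean) and deprecated in HighDimTrivialityWick.lean; source-form replacement (Aizenman 1982 Prop. 12.1 = aizenman_wickDeviation_le_finite, proved): IsingTrivialityFromDimensionFour.of_wickDeviation (IsingTrivialityFromDimensionFourWick.lean) or .of_ursellFourSum_le (IsingTrivialityFromDimensionFourTwoFacts.lean)" (since := "2026-08-15")]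
theorem IsingTrivialityFromDimensionFour.of_finiteVolumeFacts
    (hupF : aizenman_pairingSum_sub_nPoint_le_finite)
    (hS₄ : aizenmanDuminilCopin_ursellFourSum_le) (hS₅ : panis_ursellFourSum_le)
    (hF : ∀ (d : ℕ) {β : ℝ}, exists_freeMeasure d (β := β) 0)
    (hm : ∀ {d : ℕ}, spontaneousMagnetization_criticalBeta_eq_zero (d := d)) :
    IsingTrivialityFromDimensionFour := by
  intro d hd
  rintro ⟨f, hf, hfs, z, -, hnot⟩
  refine hnot ?_
  have hβ := criticalBeta_nonneg d
  have hm' : spontaneousMagnetization d (criticalBeta d) = 0 := hm (d := d) (by omega)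
  obtain ⟨μ, hμG, hTI, hcorr⟩ := hF d hβ le_rfl
  have hμ : ∀ A, spinCorr μ A = plusCorr d (criticalBeta d) 0 A := fun A =>
    (hcorr A).trans (freeCorr_eq_plusCorr_of_spontaneousMagnetization_eq_zero hβ hm' A)
  have hodd : ∀ {n : ℕ}, Odd n → ∀ x : Fin n → Site d, ∫ σ, ∏ i, spinAt (x i) σ ∂μ = 0 :=
    fun hn x => integral_prod_spinAt_eq_zero_of_freeCorr hβ hcorr hn x
  have hlow : PairingLowerBound μ :=
    pairingLowerBound_of_finite aizenman_nPoint_le_pairingSum_finite_holds hβ hcorr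
  have hup : PairingUpperBound μ := pairingUpperBound_of_finite hupF hβ hcorr
  have hS : ∀ r : ℝ, 1 ≤ r → Tendsto (fun L : ℕ => ursellFourSum μ L r) atTop (𝓝 0) := by
    rcases hd.eq_or_lt with h4 | hlt
    · subst h4
      exact fun r hr => tendsto_ursellFourSum_zero_four hS₄ hμG hr
    · exact fun r hr => tendsto_ursellFourSum_zero_highDim hS₅ hlt hμG hr
  exact tendsto_criticalSmearedMGF_one_of_pairingBounds hμG hTI hμ hlow hup hodd hS hf hfs z

/-- **The barrier from the finite-volume inequality and the random-current continuity input.** In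
`of_finiteVolumeFacts` the continuity of the magnetisation at `β_c` may be replaced by the tree's
single infinite-volume random-current input `ads_exitProb_tendsto_zero_of_lroTildeSq`
(Aizenman–Duminil-Copin–Sidoravicius 2015), through
`spontaneousMagnetization_criticalBeta_eq_zero_of_exitProb'`. Hence `IsingTrivialityFromDimensionFour`
is reduced to five named facts, each a printed statement: Aizenman's upper inequality in finite
volume, the two `∑ |U₄|` bounds (ADC 2021 Thm 1.3/§6.3; Panis 2023 §5), the free DLR state, and
this one fact. [cite: AizenmanDuminilCopinSidoraviciusCMP2015, Thm. 1.2 with Thm. 3.1] [cite: AizenmanDuminilCopinAnnals2021, Prop. 1.4 and §6.3] -/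
@[deprecated "vacuous since 2026-08-15: its hypothesis Literature.Probability.LatticeModels.aizenman_pairingSum_sub_nPoint_le_finite (the S_{2n-4} form quoted by Aizenman-Duminil-Copin 2021 (6.44)) is refuted (not_aizenman_pairingSum_sub_nPoint_le_finite, AizenmanWickBoundLocal.lean) and deprecated in HighDimTrivialityWick.lean; source-form replacement (Aizenman 1982 Prop. 12.1 = aizenman_wickDeviation_le_finite, proved): IsingTrivialityFromDimensionFour.of_wickDeviation_tendsto (IsingTrivialityFromDimensionFourWick.lean)" (since := "2026-08-15")]
theorem IsingTrivialityFromDimensionFour.of_finiteVolumeFacts_exitProb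
    (hupF : aizenman_pairingSum_sub_nPoint_le_finite)
    (hS₄ : aizenmanDuminilCopin_ursellFourSum_le) (hS₅ : panis_ursellFourSum_le)
    (hF : ∀ (d : ℕ) {β : ℝ}, exists_freeMeasure d (β := β) 0)
    (hexit : ∀ {d : ℕ}, ads_exitProb_tendsto_zero_of_lroTildeSq (d := d)) :
    IsingTrivialityFromDimensionFour :=
  IsingTrivialityFromDimensionFour.of_finiteVolumeFacts hupF hS₄ hS₅ hF
    fun {_} => spontaneousMagnetization_criticalBeta_eq_zero_of_exitProb' hexit

/-! ### 7. The corrected form of Prop. 1.4 in the `plusExpect` vocabulary is derived, not assumed -/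

/-- **Aizenman–Duminil-Copin 2021, Prop. 1.4, as its proof establishes it and p. 6 uses it, in this
barrier's `plusExpect` vocabulary — DERIVED from the tree's DLR-state fact.** There exist
`c, C > 0` such that at `β = β_c(4)`, for every `L ≥ 2`, every `r ≥ 1`, every non-negative
continuous `f` vanishing outside `[-r, r]⁴` and every real `z`,
`|⟨exp[z T_{f,L} - (z²/2)⟨T_{f,L}²⟩]⟩_{β_c} - 1| ≤ C ‖f‖_∞⁴ r¹² z⁴ / (log L)^c`, granted
`Literature.Probability.LatticeModels.aizenmanDuminilCopin_mgf_normalizedField_bound_abs` (through its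
proved corollary `.of_nonneg`), the free DLR state at `β_c` (`exists_freeMeasure`, now a theorem of
the tree for `h = 0 ≤ h`: `Literature.Probability.LatticeModels.exists_freeMeasure_holds`) and
`m*(β_c) = 0` (`spontaneousMagnetization_criticalBeta_eq_zero`), which identify the plus state at
`β_c(4)` with the free state and `criticalSmearedMGF` with the normalised exponential moment under
it (`criticalSmearedMGF_eq`). The conclusion is, symbol by symbol, the derived shape
`criticalSmearedMGF_bound_four_nonneg` recorded next to the refuted literal form in the statement
file (differences from the printed display: box radius `r ≥ 1` instead of the diameter of the
support; `f ≥ 0`). [cite: AizenmanDuminilCopinAnnals2021, Proposition 1.4 (p. 6) with §6.3 (p. 26)] -/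
theorem criticalSmearedMGF_bound_four_nonneg_of_printedBounds
    (h₁ : aizenmanDuminilCopin_mgf_normalizedField_bound_abs)
    (hF : exists_freeMeasure 4 (β := criticalBeta 4) 0)
    (hm : spontaneousMagnetization_criticalBeta_eq_zero (d := 4)) :
    ∃ c C : ℝ, 0 < c ∧ 0 < C ∧
      ∀ (f : EuclideanSpace ℝ (Fin 4) → ℝ), Continuous f → (∀ x, 0 ≤ f x) →
        ∀ (r : ℝ), 1 ≤ r → (∀ x, f x ≠ 0 → ∀ i, |x i| ≤ r) →
        ∀ (L : ℕ), 2 ≤ L → ∀ (z : ℝ),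
          |criticalSmearedMGF 4 f L z - 1| ≤ C * (⨆ x, |f x|) ^ 4 * r ^ 12 * z ^ 4 / Real.log L ^ c := by
  obtain ⟨c, C, hc, hC, H⟩ := h₁.of_nonneg
  refine ⟨c, C, hc, hC, fun f hf hf0 r hr hfr L hL z => ?_⟩
  have hβ := criticalBeta_nonneg 4
  have hm' : spontaneousMagnetization 4 (criticalBeta 4) = 0 := hm (by norm_num)
  obtain ⟨μ, hμG, -, hcorr⟩ := hF hβ le_rfl
  haveI : IsProbabilityMeasure μ := hμG.1
  have hμ : ∀ A, spinCorr μ A = plusCorr 4 (criticalBeta 4) 0 A := fun A =>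
    (hcorr A).trans (freeCorr_eq_plusCorr_of_spontaneousMagnetization_eq_zero hβ hm' A)
  have hL1 : 1 ≤ L := by omega
  have hLgt : (1 : ℝ) < (L : ℝ) := Nat.one_lt_cast.mpr (by omega)
  have key := H (criticalBeta 4) L r hβ le_rfl (Or.inl rfl) hLgt hr μ hμG f hf hfr hf0 z
  -- `criticalSmearedMGF = ∫ exp(z T - z²/2 ⟨T²⟩) dμ`
  set V : ℝ := ∫ σ, normalizedField μ L f σ ^ 2 ∂μ with hV
  have hsplit : (∫ σ, Real.exp (z * normalizedField μ L f σ - z ^ 2 / 2 * V) ∂μ) =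
      Real.exp (-(z ^ 2 / 2 * V)) * ∫ σ, Real.exp (z * normalizedField μ L f σ) ∂μ := by
    rw [← integral_const_mul (Real.exp (-(z ^ 2 / 2 * V)))]
    refine integral_congr_ae (Eventually.of_forall fun σ => ?_)
    dsimp only
    rw [sub_eq_add_neg, Real.exp_add, mul_comm]
  rw [criticalSmearedMGF_eq hμ hfr hL1 z, ← hsplit]
  exact key

/-! ### 8. The free DLR state is a theorem of the tree: four named facts remain -/

/-- **The barrier from four named facts.** With the free infinite-volume state now constructed in
the tree (`Literature.Probability.LatticeModels.exists_freeMeasure_holds`, `FreeStateGibbs`: the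
thermodynamic limit of the free boxes is a translation-invariant DLR measure with correlations
`freeCorr`, Friedli–Velenik 2017, Exercise 3.16 / Thm. 6.26), `of_finiteVolumeFacts` reduces
`IsingTrivialityFromDimensionFour` to: Aizenman's upper inequality in finite volume
(`aizenman_pairingSum_sub_nPoint_le_finite`, [Aiz82] via the switching lemma), the two bounds on
`∑ |U₄|` (`aizenmanDuminilCopin_ursellFourSum_le`, `d = 4`, ADC 2021 Thm 1.3/§6.3;
`panis_ursellFourSum_le`, `d ≥ 5`, tree diagram bound and infrared bounds), and the continuity of
the magnetisation at `β_c` (`spontaneousMagnetization_criticalBeta_eq_zero`, ADS 2015).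
[cite: AizenmanDuminilCopinAnnals2021, Prop. 1.4 and §6.3 (p. 26)] [cite: Panis2023Triviality, Thm. 5.5] -/
@[deprecated "vacuous since 2026-08-15: its hypothesis Literature.Probability.LatticeModels.aizenman_pairingSum_sub_nPoint_le_finite (the S_{2n-4} form quoted by Aizenman-Duminil-Copin 2021 (6.44)) is refuted (not_aizenman_pairingSum_sub_nPoint_le_finite, AizenmanWickBoundLocal.lean) and deprecated in HighDimTrivialityWick.lean; source-form replacement (Aizenman 1982 Prop. 12.1 = aizenman_wickDeviation_le_finite, proved): IsingTrivialityFromDimensionFour.of_wickDeviation (IsingTrivialityFromDimensionFourWick.lean) or .of_ursellFourSum_le (IsingTrivialityFromDimensionFourTwoFacts.lean)" (since := "2026-08-15")]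
theorem IsingTrivialityFromDimensionFour.of_fourFacts
    (hupF : aizenman_pairingSum_sub_nPoint_le_finite)
    (hS₄ : aizenmanDuminilCopin_ursellFourSum_le) (hS₅ : panis_ursellFourSum_le)
    (hm : ∀ {d : ℕ}, spontaneousMagnetization_criticalBeta_eq_zero (d := d)) :
    IsingTrivialityFromDimensionFour :=
  IsingTrivialityFromDimensionFour.of_finiteVolumeFacts hupF hS₄ hS₅
    (fun d => exists_freeMeasure_holds d 0) hm

/-- **The barrier from four named facts, random-current form of the continuity input**: as
`of_fourFacts`, with `m*(β_c) = 0` replaced by the tree's single infinite-volume random-current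
input `ads_exitProb_tendsto_zero_of_lroTildeSq` (Aizenman–Duminil-Copin–Sidoravicius 2015).
[cite: AizenmanDuminilCopinSidoraviciusCMP2015, Thm. 1.2 with Thm. 3.1] [cite: AizenmanDuminilCopinAnnals2021, Prop. 1.4 and §6.3] -/
@[deprecated "vacuous since 2026-08-15: its hypothesis Literature.Probability.LatticeModels.aizenman_pairingSum_sub_nPoint_le_finite (the S_{2n-4} form quoted by Aizenman-Duminil-Copin 2021 (6.44)) is refuted (not_aizenman_pairingSum_sub_nPoint_le_finite, AizenmanWickBoundLocal.lean) and deprecated in HighDimTrivialityWick.lean; source-form replacement (Aizenman 1982 Prop. 12.1 = aizenman_wickDeviation_le_finite, proved): IsingTrivialityFromDimensionFour.of_wickDeviation_tendsto (IsingTrivialityFromDimensionFourWick.lean)" (since := "2026-08-15")]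
theorem IsingTrivialityFromDimensionFour.of_fourFacts_exitProb
    (hupF : aizenman_pairingSum_sub_nPoint_le_finite)
    (hS₄ : aizenmanDuminilCopin_ursellFourSum_le) (hS₅ : panis_ursellFourSum_le)
    (hexit : ∀ {d : ℕ}, ads_exitProb_tendsto_zero_of_lroTildeSq (d := d)) :
    IsingTrivialityFromDimensionFour :=
  IsingTrivialityFromDimensionFour.of_finiteVolumeFacts_exitProb hupF hS₄ hS₅
    (fun d => exists_freeMeasure_holds d 0) @hexit

/-- **The derived shape is what the Proofs file proves, kernel-checked**: the statement file's
`criticalSmearedMGF_bound_four_nonneg` (ADC Prop. 1.4 as proved: `f ≥ 0`, box radius `r ≥ 1`)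
from the DLR-state fact, the free DLR state and `m*(β_c) = 0`
(`criticalSmearedMGF_bound_four_nonneg_of_printedBounds`, whose displayed type is this `Prop`'s
body). [cite: AizenmanDuminilCopinAnnals2021, Proposition 1.4 (p. 6) with §6.3 (p. 26)] -/
theorem criticalSmearedMGF_bound_four_nonneg.of_printedBounds
    (h₁ : aizenmanDuminilCopin_mgf_normalizedField_bound_abs)
    (hF : exists_freeMeasure 4 (β := criticalBeta 4) 0)
    (hm : spontaneousMagnetization_criticalBeta_eq_zero (d := 4)) :
    criticalSmearedMGF_bound_four_nonneg :=
  criticalSmearedMGF_bound_four_nonneg_of_printedBounds h₁ hF hm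

/-- The derived shape with the free-state input discharged (`exists_freeMeasure_holds`): from the
DLR-state fact `Literature.Probability.LatticeModels.aizenmanDuminilCopin_mgf_normalizedField_bound_abs`
and `m*(β_c) = 0` alone. [cite: AizenmanDuminilCopinAnnals2021, Proposition 1.4 (p. 6) with §6.3 (p. 26)] -/
theorem criticalSmearedMGF_bound_four_nonneg.of_facts
    (h₁ : aizenmanDuminilCopin_mgf_normalizedField_bound_abs)
    (hm : spontaneousMagnetization_criticalBeta_eq_zero (d := 4)) :
    criticalSmearedMGF_bound_four_nonneg :=
  criticalSmearedMGF_bound_four_nonneg_of_printedBounds h₁ (exists_freeMeasure_holds 4 0) hm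

/-! ### 9. Continuity at `β_c` is a theorem of the tree: three named facts remain -/

/-- **`d = 4` from two named facts.** The critical nearest-neighbour Ising model on `ℤ⁴` has no
non-Gaussian smeared scaling limit, granted Aizenman's upper inequality in finite volume
(`aizenman_pairingSum_sub_nPoint_le_finite`) and the `d = 4` bound on `∑ |U₄|` in the critical
window (`aizenmanDuminilCopin_ursellFourSum_le`, Aizenman–Duminil-Copin 2021, Thm 1.3 with §6.3):
the lower inequality (`aizenman_nPoint_le_pairingSum_finite_holds`), the free DLR state
(`exists_freeMeasure_holds`) and `m*(β_c) = 0` (`spontaneousMagnetization_criticalBeta_eq_zero_holds`,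
ADS 2015) are theorems of the tree. [cite: AizenmanDuminilCopinAnnals2021, Thm 1.3, Prop. 1.4 and §6.3 (p. 26)] -/
@[deprecated "vacuous since 2026-08-15: its hypothesis Literature.Probability.LatticeModels.aizenman_pairingSum_sub_nPoint_le_finite (the S_{2n-4} form quoted by Aizenman-Duminil-Copin 2021 (6.44)) is refuted (not_aizenman_pairingSum_sub_nPoint_le_finite, AizenmanWickBoundLocal.lean) and deprecated in HighDimTrivialityWick.lean; source-form replacement (Aizenman 1982 Prop. 12.1 = aizenman_wickDeviation_le_finite, proved): IsingTrivialityFromDimensionFour.of_ursellFourSum_le / .of_adc at d = 4 (IsingTrivialityFromDimensionFourTwoFacts.lean)" (since := "2026-08-15")]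
theorem not_hasNonGaussianCriticalSmearing_four
    (hupF : aizenman_pairingSum_sub_nPoint_le_finite)
    (hS₄ : aizenmanDuminilCopin_ursellFourSum_le) : ¬ HasNonGaussianCriticalSmearing 4 := by
  rintro ⟨f, hf, hfs, z, -, hnot⟩
  refine hnot ?_
  have hβ := criticalBeta_nonneg 4
  have hm' : spontaneousMagnetization 4 (criticalBeta 4) = 0 :=
    spontaneousMagnetization_criticalBeta_eq_zero_holds (by norm_num)
  obtain ⟨μ, hμG, hTI, hcorr⟩ := exists_freeMeasure_holds 4 0 hβ le_rfl
  have hμ : ∀ A, spinCorr μ A = plusCorr 4 (criticalBeta 4) 0 A := fun A =>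
    (hcorr A).trans (freeCorr_eq_plusCorr_of_spontaneousMagnetization_eq_zero hβ hm' A)
  have hodd : ∀ {n : ℕ}, Odd n → ∀ x : Fin n → Site 4, ∫ σ, ∏ i, spinAt (x i) σ ∂μ = 0 :=
    fun hn x => integral_prod_spinAt_eq_zero_of_freeCorr hβ hcorr hn x
  have hlow : PairingLowerBound μ :=
    pairingLowerBound_of_finite aizenman_nPoint_le_pairingSum_finite_holds hβ hcorr
  have hup : PairingUpperBound μ := pairingUpperBound_of_finite hupF hβ hcorr
  exact tendsto_criticalSmearedMGF_one_of_pairingBounds hμG hTI hμ hlow hup hodd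
    (fun r hr => tendsto_ursellFourSum_zero_four hS₄ hμG hr) hf hfs z

/-- **`d ≥ 5` from two named facts.** The critical nearest-neighbour Ising model on `ℤ^d`,
`d ≥ 5`, has no non-Gaussian smeared scaling limit, granted Aizenman's upper inequality in finite
volume (`aizenman_pairingSum_sub_nPoint_le_finite`) and the `d ≥ 5` bound on `∑ |U₄|`
(`panis_ursellFourSum_le`: tree diagram bound and infrared bounds, Aizenman 1982 / Panis 2023,
§5); the other inputs are theorems of the tree. [cite: Panis2023Triviality, Thm. 5.5 and its proof (pp. 21–22)] [cite: AizenmanCDM2020, §8.1 eq. (8.5)] -/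
@[deprecated "vacuous since 2026-08-15: its hypothesis Literature.Probability.LatticeModels.aizenman_pairingSum_sub_nPoint_le_finite (the S_{2n-4} form quoted by Aizenman-Duminil-Copin 2021 (6.44)) is refuted (not_aizenman_pairingSum_sub_nPoint_le_finite, AizenmanWickBoundLocal.lean) and deprecated in HighDimTrivialityWick.lean; source-form replacement (Aizenman 1982 Prop. 12.1 = aizenman_wickDeviation_le_finite, proved): IsingTrivialityFromDimensionFour.of_wickDeviation (IsingTrivialityFromDimensionFourWick.lean) at d >= 5, or criticalSmearedMGF_bound_highDim_abs_holds (IsingTrivialityFromDimensionFourTwoFacts.lean)" (since := "2026-08-15")]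
theorem not_hasNonGaussianCriticalSmearing_of_five_le
    (hupF : aizenman_pairingSum_sub_nPoint_le_finite) (hS₅ : panis_ursellFourSum_le)
    {d : ℕ} (hd : 5 ≤ d) : ¬ HasNonGaussianCriticalSmearing d := by
  rintro ⟨f, hf, hfs, z, -, hnot⟩
  refine hnot ?_
  have hβ := criticalBeta_nonneg d
  have hm' : spontaneousMagnetization d (criticalBeta d) = 0 :=
    spontaneousMagnetization_criticalBeta_eq_zero_holds (by omega)
  obtain ⟨μ, hμG, hTI, hcorr⟩ := exists_freeMeasure_holds d 0 hβ le_rfl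
  have hμ : ∀ A, spinCorr μ A = plusCorr d (criticalBeta d) 0 A := fun A =>
    (hcorr A).trans (freeCorr_eq_plusCorr_of_spontaneousMagnetization_eq_zero hβ hm' A)
  have hodd : ∀ {n : ℕ}, Odd n → ∀ x : Fin n → Site d, ∫ σ, ∏ i, spinAt (x i) σ ∂μ = 0 :=
    fun hn x => integral_prod_spinAt_eq_zero_of_freeCorr hβ hcorr hn x
  have hlow : PairingLowerBound μ :=
    pairingLowerBound_of_finite aizenman_nPoint_le_pairingSum_finite_holds hβ hcorr
  have hup : PairingUpperBound μ := pairingUpperBound_of_finite hupF hβ hcorr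
  exact tendsto_criticalSmearedMGF_one_of_pairingBounds hμG hTI hμ hlow hup hodd
    (fun r hr => tendsto_ursellFourSum_zero_highDim hS₅ hd hμG hr) hf hfs z

/-- **The barrier from three named facts** — the current trust base of
`IsingTrivialityFromDimensionFour`: (i) Aizenman's bound on the deviation from Wick's law in finite
volume, `aizenman_pairingSum_sub_nPoint_le_finite` ([Aiz82] Prop. 12.1 via the switching lemma; the
first display of Aizenman–Duminil-Copin 2021 §6.3, upper half); (ii) the `d = 4` bound
`aizenmanDuminilCopin_ursellFourSum_le` (ADC 2021 Thm 1.3 with §6.3 — the multiscale analysis);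
(iii) the `d ≥ 5` bound `panis_ursellFourSum_le` (tree diagram bound and infrared bounds). Everything
else in the printed proof of Prop. 1.4 / Cor. 7.3 — Gaussian domination of the `2n`-point functions,
the smearing and the summation over `n`, the free DLR state at `β_c`, the vanishing of its odd
correlations, `m*(β_c) = 0` (ADS 2015) and the identification of `⟨·⟩_{β_c}` with that state — is a
theorem of the tree. [cite: AizenmanDuminilCopinAnnals2021, Prop. 1.4 and §6.3 (p. 26)] [cite: AizenmanCDM2020, §7 Cor. 7.3] [cite: Panis2023Triviality, Thm. 5.5] -/
@[deprecated "vacuous since 2026-08-15: its hypothesis Literature.Probability.LatticeModels.aizenman_pairingSum_sub_nPoint_le_finite (the S_{2n-4} form quoted by Aizenman-Duminil-Copin 2021 (6.44)) is refuted (not_aizenman_pairingSum_sub_nPoint_le_finite, AizenmanWickBoundLocal.lean) and deprecated in HighDimTrivialityWick.lean; source-form replacement (Aizenman 1982 Prop. 12.1 = aizenman_wickDeviation_le_finite, proved): IsingTrivialityFromDimensionFour.of_wickDeviation (IsingTrivialityFromDimensionFourWick.lean: the same three inputs with Aizenman's Prop. 12.1 in its source form) or .of_ursellFourSum_le (IsingTrivialityFromDimensionFourTwoFacts.lean)"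 (since := "2026-08-15")]
theorem IsingTrivialityFromDimensionFour.of_threeFacts
    (hupF : aizenman_pairingSum_sub_nPoint_le_finite)
    (hS₄ : aizenmanDuminilCopin_ursellFourSum_le) (hS₅ : panis_ursellFourSum_le) :
    IsingTrivialityFromDimensionFour := by
  intro d hd
  rcases hd.eq_or_lt with h4 | hlt
  · subst h4
    exact not_hasNonGaussianCriticalSmearing_four hupF hS₄
  · exact not_hasNonGaussianCriticalSmearing_of_five_le hupF hS₅ hlt

/-- The statement file's derived shape of Prop. 1.4 from the DLR-state fact alone (free state and
continuity at `β_c` being theorems). [cite: AizenmanDuminilCopinAnnals2021, Proposition 1.4 (p. 6) with §6.3 (p. 26)] -/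
theorem criticalSmearedMGF_bound_four_nonneg.of_printedBound
    (h₁ : aizenmanDuminilCopin_mgf_normalizedField_bound_abs) : criticalSmearedMGF_bound_four_nonneg :=
  criticalSmearedMGF_bound_four_nonneg.of_facts h₁ spontaneousMagnetization_criticalBeta_eq_zero_holds


/-! ### 9. The `d > 4` estimate: the corrected restatements of `criticalSmearedMGF_bound_highDim` are derived

The statement file's `criticalSmearedMGF_bound_highDim` (deprecated there since 2026-08-15) transcribes the survey display of
Duminil-Copin (ICM 2022, §6.4) for every signed test function; the primary sources (Aizenman,
CDM 2020, (7.9)–(7.11) with (8.5); Panis 2023, Thm 5.5) print, for a general `f`, the prefactor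
`exp(z²/2 ⟨T_{|f|,L}²⟩)` on the un-normalised deviation. The two faithful restatements recorded in
the statement file — `criticalSmearedMGF_bound_highDim_abs` (general `f`, ratio prefactor) and
`criticalSmearedMGF_bound_highDim_nonneg` (`f ≥ 0`, the display verbatim) — are proved here from
the tree's DLR-state fact `Literature.Probability.LatticeModels.panis_mgf_normalizedField_bound`
(Panis Thm 5.5 for the nearest-neighbour model, `d ≥ 5`), the free DLR state
(`exists_freeMeasure_holds`) and `m*(β_c) = 0` (`spontaneousMagnetization_criticalBeta_eq_zero`,
or the random-current input `ads_exitProb_tendsto_zero_of_lroTildeSq`), exactly as §7 does for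
`d = 4`; the literal form implies the non-negative one; and the ratio-prefactor form still forces
`criticalSmearedMGF d f L z → 1` for every signed `f` (the prefactor is bounded in `L` by the
variance bound `integral_normalizedField_sq_le`), whence the `d > 4` half of the barrier. -/

/-- **`⟨T_{f,L}²⟩_{β_c}` as an integral.** For a finite measure `μ` with the plus correlations at
`β_c`, a test function `f` vanishing outside `[-r, r]^d` and `L ≥ 1`,
`criticalSmearedVariance d f L = ∫ (normalizedField μ L f)² dμ` (the plus state on a local
observable, `plusExpect_spinFun_eq_integral`). [cite: AizenmanDuminilCopinAnnals2021, §1.2 (T_{f,L}, Σ_L) and Prop. 1.4 (⟨T_{f,L}²⟩)] -/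
theorem criticalSmearedVariance_eq_integral {μ : Measure (SpinConfig (Site d))} [IsFiniteMeasure μ]
    (hμ : ∀ A : Finset (Site d), spinCorr μ A = plusCorr d (criticalBeta d) 0 A)
    {f : EuclideanSpace ℝ (Fin d) → ℝ} {r : ℝ} (hfr : ∀ x, f x ≠ 0 → ∀ i, |x i| ≤ r)
    {L : ℕ} (hL : 1 ≤ L) :
    criticalSmearedVariance d f L = ∫ σ, normalizedField μ L f σ ^ 2 ∂μ := by
  have hβ := criticalBeta_nonneg d
  have hL0 : ((L : ℕ) : ℝ) ≠ 0 := Nat.cast_ne_zero.mpr (by omega)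
  have hT := smearedAverage_eq_normalizedField hβ hμ L f
  set Bx : Finset (Site d) := latticeBox d (r / |((L : ℕ) : ℝ)⁻¹|) with hBx
  set s₀ : ℝ := (Real.sqrt (blockSpinVariance μ L))⁻¹ with hs₀
  have hnf : ∀ σ, normalizedField μ L f σ =
      s₀ * ∑ x ∈ Bx, f (((L : ℕ) : ℝ)⁻¹ • siteVec x) * spinAt x σ :=
    fun σ => normalizedField_eq_mul_sum μ hL0 hfr σ
  have key := plusExpect_spinFun_eq_integral hβ le_rfl hμ Bx
    (fun s => (s₀ * ∑ x ∈ Bx, f (((L : ℕ) : ℝ)⁻¹ • siteVec x) * s x) ^ 2)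
    fun s t hst => by rw [Finset.sum_congr rfl fun x hx => by rw [hst x hx]]
  have e : (fun τ => normalizedField μ L f τ ^ 2) = fun τ =>
      (fun s : Site d → ℝ => (s₀ * ∑ x ∈ Bx, f (((L : ℕ) : ℝ)⁻¹ • siteVec x) * s x) ^ 2)
        fun x => spinAt x τ := funext fun τ => by rw [hnf τ]
  unfold criticalSmearedVariance
  simp only [hT]
  rw [e, key]

/-- Griffiths' first inequality in a state carrying the plus correlations: `∫ σ_x σ_y dμ ≥ 0`
(`plusCorr_nonneg`; the diagonal terms are `∫ 1 = 1`). [folklore] -/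
theorem integral_spinAt_mul_spinAt_nonneg_of_plusCorr {β : ℝ} (hβ : 0 ≤ β)
    {μ : Measure (SpinConfig (Site d))} [IsProbabilityMeasure μ]
    (hμ : ∀ A : Finset (Site d), spinCorr μ A = plusCorr d β 0 A) (x y : Site d) :
    0 ≤ ∫ σ, spinAt x σ * spinAt y σ ∂μ := by
  classical
  by_cases hxy : x = y
  · subst hxy
    simp
  · have hpair : ∀ σ, spinAt x σ * spinAt y σ = spinProduct {x, y} σ := fun σ => by
      rw [spinProduct, Finset.prod_pair hxy]
    simp_rw [hpair]
    change 0 ≤ spinCorr μ {x, y}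
    rw [hμ]
    exact plusCorr_nonneg hβ le_rfl _

/-- **The ratio prefactor of `criticalSmearedMGF_bound_highDim_abs` is at least `1`**:
`⟨T_{f,L}²⟩_{β_c} ≤ ⟨T_{|f|,L}²⟩_{β_c}` for every compactly supported `f`, `L ≥ 1`, `d ≥ 3` — both
sides are `Σ_L⁻¹ ∑_{x,y} f(x/L) f(y/L) ⟨σ_xσ_y⟩_{β_c}` resp. with `|f|`, and `⟨σ_xσ_y⟩_{β_c} ≥ 0`
(Griffiths' first inequality; `sqMoment_mono`), granted `m*(β_c) = 0` to realise `⟨·⟩_{β_c}` on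
local observables by the free DLR state. In particular the corrected bound is never smaller than
the transcribed display, with equality of the two exactly when `⟨T_{f,L}²⟩ = ⟨T_{|f|,L}²⟩`, e.g.
`f ≥ 0`. [cite: AizenmanCDM2020, §7 eq. (7.11)] -/
theorem criticalSmearedVariance_le_abs
    (hm : ∀ {d : ℕ}, spontaneousMagnetization_criticalBeta_eq_zero (d := d)) (hd : 3 ≤ d)
    {f : EuclideanSpace ℝ (Fin d) → ℝ} (hfs : HasCompactSupport f) {L : ℕ} (hL : 1 ≤ L) :
    criticalSmearedVariance d f L ≤ criticalSmearedVariance d (fun x => |f x|) L := by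
  have hβ := criticalBeta_nonneg d
  have hm' : spontaneousMagnetization d (criticalBeta d) = 0 := hm (d := d) hd
  obtain ⟨μ, hμG, -, hcorr⟩ := exists_freeMeasure_holds d 0 hβ le_rfl
  haveI : IsProbabilityMeasure μ := hμG.1
  have hμ : ∀ A, spinCorr μ A = plusCorr d (criticalBeta d) 0 A := fun A =>
    (hcorr A).trans (freeCorr_eq_plusCorr_of_spontaneousMagnetization_eq_zero hβ hm' A)
  obtain ⟨r, -, hfr⟩ := exists_cube_of_hasCompactSupport f hfs
  have hfar : ∀ x, (fun y => |f y|) x ≠ 0 → ∀ i, |x i| ≤ r := fun x hx =>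
    hfr x (abs_ne_zero.mp hx)
  have hG := integral_spinAt_mul_spinAt_nonneg_of_plusCorr hβ hμ
  have hLpos : (0 : ℝ) < (L : ℝ) := Nat.cast_pos.mpr (by omega)
  have hS : 0 ≤ blockSpinVariance μ L := integral_nonneg fun σ => sq_nonneg _
  rw [criticalSmearedVariance_eq_integral hμ hfr hL, criticalSmearedVariance_eq_integral hμ hfar hL,
    integral_normalizedField_sq_eq μ hLpos hfr hS, integral_normalizedField_sq_eq μ hLpos hfar hS]
  exact mul_le_mul_of_nonneg_left (sqMoment_mono μ (fun x _ => le_rfl) hG) (inv_nonneg.mpr hS)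

/-- **The `d > 4` estimate with the printed `|f|`-prefactor, in the `plusExpect` vocabulary —
DERIVED** (`criticalSmearedMGF_bound_highDim_abs` of the statement file). For `d > 4` and
`f ∈ C_c(ℝ^d)` there is `C_f > 0` such that for all `L ≥ 1` and real `z`,
`|⟨exp[z T_{f,L} - (z²/2)⟨T_{f,L}²⟩]⟩_{β_c} - 1| ≤ exp((z²/2)(⟨T_{|f|,L}²⟩_{β_c} - ⟨T_{f,L}²⟩_{β_c})) · C_f z⁴ / L^{d-4}`,
granted the DLR-state fact `Literature.Probability.LatticeModels.panis_mgf_normalizedField_bound`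
(Panis 2023, Thm 5.5: the un-normalised deviation is at most
`exp(z²/2 ⟨T_{|f|,L}²⟩) C(β⁻⁴ ∨ β⁻²)‖f‖⁴_∞ r^γ z⁴ / L^{d-4}`; Aizenman CDM 2020, (7.9)–(7.10)
with (8.5)) and `m*(β_c) = 0` (`spontaneousMagnetization_criticalBeta_eq_zero`), which with the
free DLR state (`exists_freeMeasure_holds`, Lebowitz–Martin-Löf) identifies `⟨·⟩_{β_c}` on local
observables with a DLR state (`criticalSmearedMGF_eq`, `criticalSmearedVariance_eq_integral`);
one divides Panis's display by `exp((z²/2)⟨T_{f,L}²⟩) > 0` and takes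
`C_f = C(β_c⁻⁴ ∨ β_c⁻²)‖f‖⁴_∞ r^γ + 1` (`β_c > 0`, `criticalBeta_pos_holds`).
[cite: Panis2023Triviality, Thm. 5.5] [cite: AizenmanCDM2020, §7 eqs. (7.9)–(7.10) and §8.1 eq. (8.5)] -/
theorem criticalSmearedMGF_bound_highDim_abs.of_facts (h₃ : panis_mgf_normalizedField_bound)
    (hm : ∀ {d : ℕ}, spontaneousMagnetization_criticalBeta_eq_zero (d := d)) :
    criticalSmearedMGF_bound_highDim_abs := by
  intro d hd f hf hfs
  have hβ := criticalBeta_nonneg d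
  have hβc : 0 < criticalBeta d := criticalBeta_pos_holds (d := d) (by omega)
  have hm' : spontaneousMagnetization d (criticalBeta d) = 0 := hm (d := d) (by omega)
  obtain ⟨μ, hμG, -, hcorr⟩ := exists_freeMeasure_holds d 0 hβ le_rfl
  haveI : IsProbabilityMeasure μ := hμG.1
  have hμ : ∀ A, spinCorr μ A = plusCorr d (criticalBeta d) 0 A := fun A =>
    (hcorr A).trans (freeCorr_eq_plusCorr_of_spontaneousMagnetization_eq_zero hβ hm' A)
  obtain ⟨r, hr1, hfr⟩ := exists_cube_of_hasCompactSupport f hfs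
  have hfar : ∀ x, (fun y => |f y|) x ≠ 0 → ∀ i, |x i| ≤ r := fun x hx =>
    hfr x (abs_ne_zero.mp hx)
  obtain ⟨C, γ, hC, -, H⟩ := h₃ (d := d) (by omega)
  have hK0 : 0 ≤ C * max (criticalBeta d ^ (-4 : ℤ)) (criticalBeta d ^ (-2 : ℤ)) *
      (⨆ x, |f x|) ^ 4 * r ^ γ := by
    have h1 : 0 ≤ max (criticalBeta d ^ (-4 : ℤ)) (criticalBeta d ^ (-2 : ℤ)) :=
      le_max_of_le_left (zpow_nonneg hβ _)
    have h2 : 0 ≤ (⨆ x, |f x|) ^ 4 := pow_nonneg (iSup_abs_nonneg f) 4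
    have h3 : 0 ≤ r ^ γ := Real.rpow_nonneg (zero_le_one.trans hr1) γ
    exact mul_nonneg (mul_nonneg (mul_nonneg hC.le h1) h2) h3
  set K : ℝ := C * max (criticalBeta d ^ (-4 : ℤ)) (criticalBeta d ^ (-2 : ℤ)) *
    (⨆ x, |f x|) ^ 4 * r ^ γ with hK
  refine ⟨K + 1, by linarith, fun L hL z => ?_⟩
  have hL1 : (1 : ℝ) ≤ (L : ℝ) := Nat.one_le_cast.mpr hL
  have hLp : 0 < (L : ℝ) ^ (d - 4) := pow_pos (Nat.cast_pos.mpr (by omega)) _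
  have key := H (criticalBeta d) L r hβc le_rfl hL1 hr1 μ hμG f hf hfr z
  rw [← hK] at key
  set V : ℝ := ∫ σ, normalizedField μ L f σ ^ 2 ∂μ with hV
  set W : ℝ := ∫ σ, normalizedField μ L (fun x => |f x|) σ ^ 2 ∂μ with hW
  rw [criticalSmearedVariance_eq_integral hμ hfar hL, criticalSmearedVariance_eq_integral hμ hfr hL,
    criticalSmearedMGF_eq hμ hfr hL z]
  have hpos : 0 < Real.exp (z ^ 2 / 2 * V) := Real.exp_pos _
  have h1 : Real.exp (-(z ^ 2 / 2 * V)) * (∫ σ, Real.exp (z * normalizedField μ L f σ) ∂μ) - 1 =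
      Real.exp (-(z ^ 2 / 2 * V)) *
        ((∫ σ, Real.exp (z * normalizedField μ L f σ) ∂μ) - Real.exp (z ^ 2 / 2 * V)) := by
    rw [mul_sub, Real.exp_neg, inv_mul_cancel₀ hpos.ne']
  rw [h1, abs_mul, Real.abs_exp]
  have hz4 : 0 ≤ z ^ 4 := by positivity
  calc Real.exp (-(z ^ 2 / 2 * V)) *
        |(∫ σ, Real.exp (z * normalizedField μ L f σ) ∂μ) - Real.exp (z ^ 2 / 2 * V)|
      ≤ Real.exp (-(z ^ 2 / 2 * V)) * (Real.exp (z ^ 2 / 2 * W) * (K * z ^ 4 / (L : ℝ) ^ (d - 4))) :=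
        mul_le_mul_of_nonneg_left key (Real.exp_pos _).le
    _ ≤ Real.exp (-(z ^ 2 / 2 * V)) *
        (Real.exp (z ^ 2 / 2 * W) * ((K + 1) * z ^ 4 / (L : ℝ) ^ (d - 4))) := by
        gcongr
        linarith
    _ = Real.exp (z ^ 2 / 2 * (W - V)) * ((K + 1) * z ^ 4 / (L : ℝ) ^ (d - 4)) := by
        have e : -(z ^ 2 / 2 * V) + z ^ 2 / 2 * W = z ^ 2 / 2 * (W - V) := by ring
        rw [← mul_assoc, ← Real.exp_add, e]

/-- The same, with `m*(β_c) = 0` replaced by the tree's single infinite-volume random-current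
input of Aizenman–Duminil-Copin–Sidoravicius 2015 (`ads_exitProb_tendsto_zero_of_lroTildeSq`,
through `spontaneousMagnetization_criticalBeta_eq_zero_of_exitProb'`).
[cite: AizenmanDuminilCopinSidoraviciusCMP2015, Thm. 1.2 with Thm. 3.1] [cite: Panis2023Triviality, Thm. 5.5] -/
theorem criticalSmearedMGF_bound_highDim_abs.of_exitProb (h₃ : panis_mgf_normalizedField_bound)
    (hexit : ∀ {d : ℕ}, ads_exitProb_tendsto_zero_of_lroTildeSq (d := d)) :
    criticalSmearedMGF_bound_highDim_abs :=
  criticalSmearedMGF_bound_highDim_abs.of_facts h₃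
    fun {_} => spontaneousMagnetization_criticalBeta_eq_zero_of_exitProb' hexit

/-- **The survey display for `f ≥ 0`, in the `plusExpect` vocabulary — DERIVED**
(`criticalSmearedMGF_bound_highDim_nonneg` of the statement file: for `d > 4`, `f ∈ C_c(ℝ^d)`,
`f ≥ 0`, some `C_f > 0`, all `L ≥ 1` and real `z`,
`|⟨exp[z T_{f,L} - (z²/2)⟨T_{f,L}²⟩]⟩_{β_c} - 1| ≤ C_f z⁴ / L^{d-4}`), from
`Literature.Probability.LatticeModels.panis_mgf_normalizedField_bound` and `m*(β_c) = 0`: for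
`f ≥ 0` the ratio prefactor of `criticalSmearedMGF_bound_highDim_abs` is `1`.
[cite: DuminilCopinICM2022, §6.4 (display)] [cite: Panis2023Triviality, Thm. 5.5] [cite: AizenmanCDM2020, §7 eq. (7.9) and §8.1 eq. (8.5)] -/
theorem criticalSmearedMGF_bound_highDim_nonneg.of_facts (h₃ : panis_mgf_normalizedField_bound)
    (hm : ∀ {d : ℕ}, spontaneousMagnetization_criticalBeta_eq_zero (d := d)) :
    criticalSmearedMGF_bound_highDim_nonneg :=
  (criticalSmearedMGF_bound_highDim_abs.of_facts h₃ hm).nonneg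

/-- The same with the random-current continuity input.
[cite: AizenmanDuminilCopinSidoraviciusCMP2015, Thm. 1.2 with Thm. 3.1] [cite: Panis2023Triviality, Thm. 5.5] -/
theorem criticalSmearedMGF_bound_highDim_nonneg.of_exitProb (h₃ : panis_mgf_normalizedField_bound)
    (hexit : ∀ {d : ℕ}, ads_exitProb_tendsto_zero_of_lroTildeSq (d := d)) :
    criticalSmearedMGF_bound_highDim_nonneg :=
  (criticalSmearedMGF_bound_highDim_abs.of_exitProb h₃ @hexit).nonneg

/-- `T_{-f,L} = -T_{f,L}`. [folklore] -/
theorem smearedAverage_neg (d : ℕ) (β : ℝ) (L : ℕ) (f : EuclideanSpace ℝ (Fin d) → ℝ)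
    (σ : SpinConfig (Site d)) :
    smearedAverage d β L (fun x => -f x) σ = -smearedAverage d β L f σ := by
  simp only [smearedAverage, neg_mul, finsum_neg_distrib, neg_div]

/-- `⟨exp[(-z) T_{-f,L} - ((-z)²/2)⟨T_{-f,L}²⟩]⟩_{β_c} = ⟨exp[z T_{f,L} - (z²/2)⟨T_{f,L}²⟩]⟩_{β_c}`
(`T_{-f,L} = -T_{f,L}`). [folklore] -/
theorem criticalSmearedMGF_neg_neg (d : ℕ) (f : EuclideanSpace ℝ (Fin d) → ℝ) (L : ℕ) (z : ℝ) :
    criticalSmearedMGF d (fun x => -f x) L (-z) = criticalSmearedMGF d f L z := by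
  unfold criticalSmearedMGF
  simp only [smearedAverage_neg, neg_mul_neg, neg_sq]

/-- At `z = 0` the critical smeared moment generating function is `⟨1⟩_{β_c} = 1`. [folklore] -/
theorem criticalSmearedMGF_zero (d : ℕ) (f : EuclideanSpace ℝ (Fin d) → ℝ) (L : ℕ) :
    criticalSmearedMGF d f L 0 = 1 := by
  unfold criticalSmearedMGF
  simp only [zero_mul, ne_eq, OfNat.ofNat_ne_zero, not_false_eq_true, zero_pow, zero_div,
    sub_zero, Real.exp_zero]
  exact plusExpect_const d _ 0 1

-- `linter.deprecated` off for this declaration only: it compares the deprecated literal transcription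
-- `criticalSmearedMGF_bound_highDim` with its corrected restatement, and is deprecated with it.
set_option linter.deprecated false in
/-- **Deprecated record (2026-08-15) — the literal form implies the non-negative restatement.**
The deprecated literal transcription `criticalSmearedMGF_bound_highDim` of the statement file
(every signed `f`, `z > 0`) gives `criticalSmearedMGF_bound_highDim_nonneg` (`f ≥ 0`, all real
`z`): for `z < 0` apply the literal bound to `-f` at `-z > 0` (`criticalSmearedMGF_neg_neg`), and
at `z = 0` both sides vanish; the constant is `max(C_f, C_{-f})`. So the corrected fact is a
weakening of the transcribed display on its own range; the live comparison is
`criticalSmearedMGF_bound_highDim_abs.nonneg` (statement file). [cite: DuminilCopinICM2022, §6.4] -/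
@[deprecated criticalSmearedMGF_bound_highDim_abs.nonneg (since := "2026-08-15")]
theorem criticalSmearedMGF_bound_highDim.nonneg (h : criticalSmearedMGF_bound_highDim) :
    criticalSmearedMGF_bound_highDim_nonneg := by
  intro d hd f hf hfs _
  obtain ⟨C₁, hC₁, H₁⟩ := h d hd f hf hfs
  obtain ⟨C₂, -, H₂⟩ := h d hd (fun x => -f x) hf.neg hfs.neg
  refine ⟨max C₁ C₂, lt_max_of_lt_left hC₁, fun L hL z => ?_⟩
  have hLp : 0 < (L : ℝ) ^ (d - 4) := pow_pos (Nat.cast_pos.mpr (by omega)) _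
  rcases lt_trichotomy z 0 with hz | rfl | hz
  · rw [← criticalSmearedMGF_neg_neg d f L z]
    calc |criticalSmearedMGF d (fun x => -f x) L (-z) - 1| ≤ C₂ * (-z) ^ 4 / (L : ℝ) ^ (d - 4) :=
          H₂ L hL (-z) (neg_pos.mpr hz)
      _ = C₂ * z ^ 4 / (L : ℝ) ^ (d - 4) := by rw [(by decide : Even 4).neg_pow z]
      _ ≤ max C₁ C₂ * z ^ 4 / (L : ℝ) ^ (d - 4) := by
          gcongr
          exact le_max_right _ _
  · rw [criticalSmearedMGF_zero, sub_self, abs_zero]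
    have e : max C₁ C₂ * (0 : ℝ) ^ 4 / (L : ℝ) ^ (d - 4) = 0 := by simp
    rw [e]
  · calc |criticalSmearedMGF d f L z - 1| ≤ C₁ * z ^ 4 / (L : ℝ) ^ (d - 4) := H₁ L hL z hz
      _ ≤ max C₁ C₂ * z ^ 4 / (L : ℝ) ^ (d - 4) := by
          gcongr
          exact le_max_left _ _

/-- **`criticalSmearedMGF d f L z → 1` for every SIGNED `f` from the ratio-prefactor form.** The
prefactor `exp((z²/2)(⟨T_{|f|,L}²⟩_{β_c} - ⟨T_{f,L}²⟩_{β_c}))` of `criticalSmearedMGF_bound_highDim_abs`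
is bounded uniformly in `L ≥ 1`: `⟨T_{f,L}²⟩ ≥ 0` and `⟨T_{|f|,L}²⟩ ≤ ‖f‖²_∞ (2(⌈r⌉+1)+1)^{2d}` by
translation invariance and Griffiths' first inequality (`integral_normalizedField_sq_le`, under
the free DLR state, which carries the plus correlations at `β_c` since `m*(β_c) = 0`); hence
`|criticalSmearedMGF d f L z - 1| ≤ K_{f,z} / L^{d-4} → 0` (Aizenman, CDM 2020, Cor. 7.3 with
(7.9)–(7.11)). [cite: AizenmanCDM2020, §7 Cor. 7.3 with eqs. (7.9)–(7.11)] -/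
theorem criticalSmearedMGF_bound_highDim_abs.tendsto (h : criticalSmearedMGF_bound_highDim_abs)
    (hm : ∀ {d : ℕ}, spontaneousMagnetization_criticalBeta_eq_zero (d := d))
    (hd : 4 < d) {f : EuclideanSpace ℝ (Fin d) → ℝ} (hf : Continuous f)
    (hfs : HasCompactSupport f) (z : ℝ) :
    Tendsto (fun L : ℕ => criticalSmearedMGF d f L z) atTop (𝓝 1) := by
  obtain ⟨C, hC, H⟩ := h d hd f hf hfs
  have hβ := criticalBeta_nonneg d
  have hm' : spontaneousMagnetization d (criticalBeta d) = 0 := hm (d := d) (by omega)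
  obtain ⟨μ, hμG, hTI, hcorr⟩ := exists_freeMeasure_holds d 0 hβ le_rfl
  haveI : IsProbabilityMeasure μ := hμG.1
  have hμ : ∀ A, spinCorr μ A = plusCorr d (criticalBeta d) 0 A := fun A =>
    (hcorr A).trans (freeCorr_eq_plusCorr_of_spontaneousMagnetization_eq_zero hβ hm' A)
  obtain ⟨r, hr1, hfr⟩ := exists_cube_of_hasCompactSupport f hfs
  have hfar : ∀ x, (fun y => |f y|) x ≠ 0 → ∀ i, |x i| ≤ r := fun x hx =>
    hfr x (abs_ne_zero.mp hx)
  have hG := integral_spinAt_mul_spinAt_nonneg_of_plusCorr hβ hμ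
  set Cv : ℝ := (⨆ x, |(|f x|)|) ^ 2 * ((((2 * (⌈r⌉₊ + 1) + 1) ^ d : ℕ) : ℝ) ^ 2) with hCv
  have hvar : ∀ L : ℕ, 1 ≤ L →
      criticalSmearedVariance d (fun x => |f x|) L - criticalSmearedVariance d f L ≤ Cv := by
    intro L hL
    rw [criticalSmearedVariance_eq_integral hμ hfar hL, criticalSmearedVariance_eq_integral hμ hfr hL]
    have h1 := integral_normalizedField_sq_le μ hTI hG hf.abs hr1 hfar (Nat.one_le_cast.mpr hL)
    have h2 : 0 ≤ ∫ σ, normalizedField μ L f σ ^ 2 ∂μ := integral_nonneg fun σ => sq_nonneg _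
    linarith
  set K : ℝ := Real.exp (z ^ 2 / 2 * Cv) * (C * z ^ 4) with hK
  refine tendsto_one_of_abs_sub_le (L₀ := 1) (g := fun L : ℕ => K / (L : ℝ) ^ (d - 4))
    (fun L hL => ?_) ?_
  · have hLp : 0 < (L : ℝ) ^ (d - 4) := pow_pos (Nat.cast_pos.mpr (by omega)) _
    calc |criticalSmearedMGF d f L z - 1|
        ≤ Real.exp (z ^ 2 / 2 * (criticalSmearedVariance d (fun x => |f x|) L -
            criticalSmearedVariance d f L)) * (C * z ^ 4 / (L : ℝ) ^ (d - 4)) := H L hL z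
      _ ≤ Real.exp (z ^ 2 / 2 * Cv) * (C * z ^ 4 / (L : ℝ) ^ (d - 4)) := by
          gcongr
          exact hvar L hL
      _ = K / (L : ℝ) ^ (d - 4) := by rw [hK]; ring
  · have hpow : Tendsto (fun L : ℕ => ((L : ℝ) ^ (d - 4))⁻¹) atTop (𝓝 0) := by
      have h1 : Tendsto (fun x : ℝ => x ^ (d - 4)) atTop atTop := tendsto_pow_atTop (by omega)
      exact (h1.comp tendsto_natCast_atTop_atTop).inv_tendsto_atTop
    simpa [div_eq_mul_inv] using hpow.const_mul K

/-- **The `d > 4` half of the barrier from the corrected fact**: granted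
`criticalSmearedMGF_bound_highDim_abs` and `m*(β_c) = 0`, no `d > 4` carries a non-Gaussian
critical smearing (Aizenman 1982, Fröhlich 1982; Aizenman CDM 2020, Thm 2.2 / Cor. 7.3).
[cite: AizenmanCDM2020, Theorem 2.2 and §7 Cor. 7.3] [cite: DuminilCopinICM2022, §6.4] -/
theorem criticalSmearedMGF_bound_highDim_abs.not_hasNonGaussianCriticalSmearing
    (h : criticalSmearedMGF_bound_highDim_abs)
    (hm : ∀ {d : ℕ}, spontaneousMagnetization_criticalBeta_eq_zero (d := d)) (hd : 4 < d) :
    ¬ HasNonGaussianCriticalSmearing d := by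
  rintro ⟨f, hf, hfs, z, -, hnot⟩
  exact hnot (h.tendsto hm hd hf hfs z)

/-- **The `d > 4` half of the barrier from the tree's facts through the corrected restatement**:
`panis_mgf_normalizedField_bound` and `m*(β_c) = 0` exclude a non-Gaussian critical smearing in
every `d > 4` (the route `of_printedBounds` takes for `d ≥ 5`, factored through
`criticalSmearedMGF_bound_highDim_abs`). [cite: Panis2023Triviality, Thm. 5.5 and Cor. 1.8] [cite: AizenmanCDM2020, Theorem 2.2] -/
theorem not_hasNonGaussianCriticalSmearing_of_printedBounds_highDim
    (h₃ : panis_mgf_normalizedField_bound)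
    (hm : ∀ {d : ℕ}, spontaneousMagnetization_criticalBeta_eq_zero (d := d)) (hd : 4 < d) :
    ¬ HasNonGaussianCriticalSmearing d :=
  (criticalSmearedMGF_bound_highDim_abs.of_facts h₃ hm).not_hasNonGaussianCriticalSmearing hm hd

end Literature.Barriers.CriticalPhenomena
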